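import Literature.NumberTheory.Sieve.MaynardNFWeights
import HarnessLib

/-!
# The Maynard–Tao sieve over `𝓞_K`: the bilinear forms of Lemmas 5.1–5.2 in the variables `y_𝔯`, `y^{(m)}_𝔯`

Topic `Literature/NumberTheory/Sieve`. The number-field port of the tree's
`Sieve/MaynardSieveBilinear.lean` (J. Maynard, *Small gaps between primes*, Ann. of Math. 181
(2015), §5, Lemmas 5.1–5.2, displays (5.4)–(5.26)), as used by A. Castillo, C. Hall,
R. J. Lemke Oliver, P. Pollack, L. Thompson, *Bounded gaps between primes in number fields and
function fields*, Proc. AMS 143 (2015), arXiv:1403.5808, §2.2 (proof of Proposition 2.1: "The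
proof follows [Maynard] … with integers replaced by ideals"). Integers are replaced by nonzero ideals
of `𝓞_K`, `d` by `N𝔡`, `φ` by `φ(𝔡) = N𝔡∏_{𝔭∣𝔡}(1 − 1/N𝔭)`, `μ` by the Möbius function of ideals,
`gcd` by `𝔡 + 𝔢`, `lcm` by `𝔡 ∩ 𝔢` (`(𝔡 + 𝔢)(𝔡 ∩ 𝔢) = 𝔡𝔢`, Mathlib's `Ideal.sup_mul_inf`) and
coprimality to `W` by comaximality with the ideal `𝔴`. Everything in this file is PROVED; the file
mirrors the `ℤ` file declaration by declaration (same names in the namespace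
`Literature.NumberTheory.Sieve.MaynardNF`).

* Tuples: `IsGood 𝔴 𝔯` (`∏ 𝔯ᵢ` square-free and comaximal with `𝔴`), `lam K k B y` (**λ in terms of
  y**, Maynard (5.10)), `SupportedOn`, `sum_lam_div_prod_eq` — the inversion (5.8)/(5.9);
* the bilinear forms for a coprime-multiplicative pair `(ψ, ρ)` with `ψ(𝔫) = ∑_{𝔲∣𝔫} ρ(𝔲)` on the
  good scalars `G1 K 𝔴 B`: `term_expand`, `bilinear_rearrange` ((5.5)–(5.8)), the vanishing analysis
  `coprime_of_isGood_rowT_colT`, `diag_term_eq`, `abs_offdiag_term_le`, and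
  **`abs_bilinear_sub_diag_le`** (+ `_slot`): `|∑' − ∑_𝔲 Y_𝔲²/∏ρ(𝔲ᵢ)| ≤ Y_max² L_ρ^k (Z_ρ^K − 1)`;
* instances `(ψ, ρ) = (N, φ)` (**`abs_S1main_sub_le`**, Lemma 5.1 main term, via `Yv_lam_eq : Y = y`)
  and `(ψ, ρ) = (φ, g)`, `g(𝔲) = ∏_{𝔭∣𝔲}(N𝔭 − 2)` (**`abs_S2main_sub_le`**, Lemma 5.2 main term, for
  `𝔴` divisible by every prime of norm `2`);
* `abs_lam_le` — `λ_max ≤ y_max L^{2k}` ((5.9), crude form).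

## References

* A. Castillo et al., arXiv:1403.5808, §2.2, Proposition 2.1. [cite: CastilloEtAl2015, §2.2]
* J. Maynard, Ann. of Math. 181 (2015), Lemmas 5.1–5.2, (5.4)–(5.26). [cite: MaynardAnnals2015, §5]
-/

noncomputable section

open Finset UniqueFactorizationMonoid IsDedekindDomain
open scoped NumberField Classical

namespace Literature.NumberTheory.Sieve.MaynardNF

open UniqueFactorizationMonoid Literature.NumberTheory.LFunctions
  Literature.NumberTheory.LFunctions.NumberField

variable {K : Type*} [Field K] [NumberField K]
variable {k : ℕ}

/-! ### Good tuples of ideals -/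

/-- A tuple of ideals is *good* (for the modulus `𝔴`) if the product of its entries is square-free
and comaximal with `𝔴` — the support condition on the variables `y_{𝔯₁,…,𝔯_k}` (Castillo et al.
§2.2, following Maynard §5: "`y` supported on `∏ 𝔯ᵢ` square-free and coprime to `𝔴`").
[cite: CastilloEtAl2015, §2.2] -/
def IsGood (𝔴 : Ideal (𝓞 K)) (𝔯 : Fin k → Ideal (𝓞 K)) : Prop :=
  Squarefree (∏ i, 𝔯 i) ∧ (∏ i, 𝔯 i) ⊔ 𝔴 = ⊤

omit [NumberField K] in
/-- The product of a good tuple is square-free. [folklore] -/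
theorem IsGood.squarefree {𝔴 : Ideal (𝓞 K)} {𝔯 : Fin k → Ideal (𝓞 K)} (h : IsGood 𝔴 𝔯) :
    Squarefree (∏ i, 𝔯 i) := h.1

omit [NumberField K] in
/-- The product of a good tuple is comaximal with `𝔴`. [folklore] -/
theorem IsGood.sup_eq_top {𝔴 : Ideal (𝓞 K)} {𝔯 : Fin k → Ideal (𝓞 K)} (h : IsGood 𝔴 𝔯) :
    (∏ i, 𝔯 i) ⊔ 𝔴 = ⊤ := h.2

omit [NumberField K] in
/-- Each entry of a good tuple is square-free. [folklore] -/
theorem IsGood.squarefree_apply {𝔴 : Ideal (𝓞 K)} {𝔯 : Fin k → Ideal (𝓞 K)} (h : IsGood 𝔴 𝔯)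
    (i : Fin k) : Squarefree (𝔯 i) :=
  h.1.squarefree_of_dvd (Finset.dvd_prod_of_mem _ (Finset.mem_univ i))

omit [NumberField K] in
/-- Comaximality passes to divisors: `𝔞 ∣ 𝔟`, `𝔟 + 𝔴 = (1)` imply `𝔞 + 𝔴 = (1)`. [folklore] -/
theorem sup_eq_top_of_dvd {𝔞 𝔟 𝔴 : Ideal (𝓞 K)} (hab : 𝔞 ∣ 𝔟) (h : 𝔟 ⊔ 𝔴 = ⊤) : 𝔞 ⊔ 𝔴 = ⊤ := by
  rw [eq_top_iff, ← h]
  exact sup_le_sup_right (Ideal.le_of_dvd hab) _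

omit [NumberField K] in
/-- Each entry of a good tuple is comaximal with `𝔴`. [folklore] -/
theorem IsGood.sup_eq_top_apply {𝔴 : Ideal (𝓞 K)} {𝔯 : Fin k → Ideal (𝓞 K)} (h : IsGood 𝔴 𝔯)
    (i : Fin k) : 𝔯 i ⊔ 𝔴 = ⊤ :=
  sup_eq_top_of_dvd (Finset.dvd_prod_of_mem _ (Finset.mem_univ i)) h.2

omit [NumberField K] in
/-- Each entry of a good tuple is nonzero. [folklore] -/
theorem IsGood.ne_bot {𝔴 : Ideal (𝓞 K)} {𝔯 : Fin k → Ideal (𝓞 K)} (h : IsGood 𝔴 𝔯) (i : Fin k) :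
    𝔯 i ≠ ⊥ := by
  rw [Ne, ← Ideal.zero_eq_bot]
  exact (h.squarefree_apply i).ne_zero

/-- Distinct entries of a good tuple are comaximal. [folklore] -/
theorem IsGood.sup_eq_top_of_ne {𝔴 : Ideal (𝓞 K)} {𝔯 : Fin k → Ideal (𝓞 K)} (h : IsGood 𝔴 𝔯)
    {i j : Fin k} (hij : i ≠ j) : 𝔯 i ⊔ 𝔯 j = ⊤ := by
  have : 𝔯 i * 𝔯 j ∣ ∏ l, 𝔯 l := by
    rw [← Finset.prod_pair hij]
    exact Finset.prod_dvd_prod_of_subset _ _ _ (by simp [Finset.subset_iff])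
  exact sup_eq_top_of_squarefree_mul (h.1.squarefree_of_dvd this)

omit [NumberField K] in
/-- A good tuple divided entrywise stays good. [folklore] -/
theorem IsGood.of_dvd {𝔴 : Ideal (𝓞 K)} {A 𝔯 : Fin k → Ideal (𝓞 K)} (h : IsGood 𝔴 𝔯)
    (hA : ∀ i, A i ∣ 𝔯 i) : IsGood 𝔴 A := by
  have hdvd : ∏ i, A i ∣ ∏ i, 𝔯 i := Finset.prod_dvd_prod_of_dvd _ _ fun i _ => hA i
  exact ⟨h.1.squarefree_of_dvd hdvd, sup_eq_top_of_dvd hdvd h.2⟩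

/-! ### Maynard's weights `λ_𝔡` from the diagonal variables `y_𝔯` (arbitrary `y`) -/

variable (K) in
/-- **`λ` in terms of `y`** over `𝓞_K` (Maynard (5.10) with ideals):
`λ_{𝔡₁…𝔡_k} = (∏ μ(𝔡ᵢ)N𝔡ᵢ) ∑_{𝔡ᵢ∣𝔯ᵢ} y_𝔯/∏ φ(𝔯ᵢ)`, the sum running over the box `0 < N𝔯ᵢ ≤ B`.
[cite: CastilloEtAl2015, §2.2] -/
def lam (k : ℕ) (B : ℝ) (y : (Fin k → Ideal (𝓞 K)) → ℝ) (𝔡 : Fin k → Ideal (𝓞 K)) : ℝ :=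
  (∏ i, (idealMoebius (𝔡 i) : ℝ) * (Ideal.absNorm (𝔡 i) : ℝ)) *
    ∑ 𝔯 ∈ (box K k B).filter (fun 𝔯 => ∀ i, 𝔡 i ∣ 𝔯 i), y 𝔯 / ∏ i, idealTotient K (𝔯 i)

/-- Unfolding `lam`. [folklore] -/
theorem lam_def (B : ℝ) (y : (Fin k → Ideal (𝓞 K)) → ℝ) (𝔡 : Fin k → Ideal (𝓞 K)) :
    lam K k B y 𝔡 = (∏ i, (idealMoebius (𝔡 i) : ℝ) * (Ideal.absNorm (𝔡 i) : ℝ)) *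
      ∑ 𝔯 ∈ (box K k B).filter (fun 𝔯 => ∀ i, 𝔡 i ∣ 𝔯 i), y 𝔯 / ∏ i, idealTotient K (𝔯 i) := rfl

variable (K) in
/-- The support hypothesis on `y`: `y_𝔯 = 0` unless `𝔯` lies in the box and is good.
[cite: CastilloEtAl2015, §2.2] -/
def SupportedOn (k : ℕ) (𝔴 : Ideal (𝓞 K)) (B : ℝ) (y : (Fin k → Ideal (𝓞 K)) → ℝ) : Prop :=
  ∀ 𝔯, y 𝔯 ≠ 0 → 𝔯 ∈ box K k B ∧ IsGood 𝔴 𝔯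

/-- The per-coordinate divisor sets: for `𝔯` in the box, the divisors of `𝔯ᵢ` are the members of
`idealsLE K B` dividing `𝔯ᵢ`. [folklore] -/
theorem mem_filter_dvd_iff_of_mem_box {B : ℝ} {𝔯 : Fin k → Ideal (𝓞 K)} (hr : 𝔯 ∈ box K k B)
    (i : Fin k) (𝔡 : Ideal (𝓞 K)) : 𝔡 ∈ (idealsLE K B).filter (· ∣ 𝔯 i) ↔ 𝔡 ∣ 𝔯 i := by
  have hr' := mem_box_iff.1 hr
  rw [Finset.mem_filter, mem_idealsLE]
  constructor
  · exact fun h => h.2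
  · intro h
    have h𝔡0 : 𝔡 ≠ ⊥ := by
      intro h0; rw [h0, Ideal.dvd_iff_le, le_bot_iff] at h; exact (hr' i).1 h
    refine ⟨⟨h𝔡0, le_trans ?_ (hr' i).2⟩, h⟩
    have hN : Ideal.absNorm (𝔯 i) ≠ 0 := by rw [Ne, Ideal.absNorm_eq_zero_iff]; exact (hr' i).1
    exact_mod_cast Nat.le_of_dvd (Nat.pos_of_ne_zero hN) (map_dvd _ h)

/-- The tuples `𝔡` of the box with `Aᵢ ∣ 𝔡ᵢ ∣ 𝔯ᵢ` form the product of the per-coordinate divisor sets.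
[folklore] -/
theorem filter_box_dvd_dvd_eq {B : ℝ} (A 𝔯 : Fin k → Ideal (𝓞 K)) :
    (box K k B).filter (fun 𝔡 => (∀ i, A i ∣ 𝔡 i) ∧ ∀ i, 𝔡 i ∣ 𝔯 i) =
      Fintype.piFinset fun i => ((idealsLE K B).filter (· ∣ 𝔯 i)).filter (A i ∣ ·) := by
  ext 𝔡
  simp only [Finset.mem_filter, Fintype.mem_piFinset, box]
  constructor
  · rintro ⟨hd, hA, hdr⟩ i
    exact ⟨⟨hd i, hdr i⟩, hA i⟩
  · intro h
    exact ⟨fun i => (h i).1.1, fun i => (h i).2, fun i => (h i).1.2⟩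

/-- **The inversion formula** over `𝓞_K` (Maynard (5.9) read backwards): for `y` supported on good
tuples of the box and any tuple `A`,
`∑_{𝔡 : Aᵢ ∣ 𝔡ᵢ} λ_𝔡/∏ N𝔡ᵢ = (∏ μ(Aᵢ)) y_A/∏ φ(Aᵢ)`. [cite: CastilloEtAl2015, §2.2] -/
theorem sum_lam_div_prod_eq {𝔴 : Ideal (𝓞 K)} {B : ℝ} {y : (Fin k → Ideal (𝓞 K)) → ℝ}
    (hy : SupportedOn K k 𝔴 B y) (A : Fin k → Ideal (𝓞 K)) :
    ∑ 𝔡 ∈ (box K k B).filter (fun 𝔡 => ∀ i, A i ∣ 𝔡 i), lam K k B y 𝔡 / ∏ i, (Ideal.absNorm (𝔡 i) : ℝ) =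
      (∏ i, (idealMoebius (A i) : ℝ)) * y A / ∏ i, idealTotient K (A i) := by
  -- Step 1: `λ_𝔡/∏ N𝔡ᵢ = (∏ μ(𝔡ᵢ)) ∑_{𝔡 ∣ 𝔯} y_𝔯/∏ φ(𝔯ᵢ)` on the box.
  have step1 : ∀ 𝔡 ∈ (box K k B).filter (fun 𝔡 => ∀ i, A i ∣ 𝔡 i),
      lam K k B y 𝔡 / ∏ i, (Ideal.absNorm (𝔡 i) : ℝ) =
        ∑ 𝔯 ∈ (box K k B).filter (fun 𝔯 => ∀ i, 𝔡 i ∣ 𝔯 i),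
          (∏ i, (idealMoebius (𝔡 i) : ℝ)) * (y 𝔯 / ∏ i, idealTotient K (𝔯 i)) := by
    intro 𝔡 hd
    rw [Finset.mem_filter, mem_box_iff] at hd
    have hd0 : ∏ i, (Ideal.absNorm (𝔡 i) : ℝ) ≠ 0 := Finset.prod_ne_zero_iff.2 fun i _ => by
      exact_mod_cast (Nat.pos_of_ne_zero (by rw [Ne, Ideal.absNorm_eq_zero_iff]; exact (hd.1 i).1)).ne'
    rw [lam_def, Finset.prod_mul_distrib, mul_right_comm, mul_div_cancel_right₀ _ hd0, Finset.mul_sum]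
  rw [Finset.sum_congr rfl step1]
  -- Step 2: write both sums over the box with indicators and swap.
  have step2 : ∑ 𝔡 ∈ (box K k B).filter (fun 𝔡 => ∀ i, A i ∣ 𝔡 i),
      ∑ 𝔯 ∈ (box K k B).filter (fun 𝔯 => ∀ i, 𝔡 i ∣ 𝔯 i),
        (∏ i, (idealMoebius (𝔡 i) : ℝ)) * (y 𝔯 / ∏ i, idealTotient K (𝔯 i)) =
      ∑ 𝔯 ∈ box K k B, (y 𝔯 / ∏ i, idealTotient K (𝔯 i)) *
        ∑ 𝔡 ∈ (box K k B).filter (fun 𝔡 => (∀ i, A i ∣ 𝔡 i) ∧ ∀ i, 𝔡 i ∣ 𝔯 i),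
          ∏ i, (idealMoebius (𝔡 i) : ℝ) := by
    calc ∑ 𝔡 ∈ (box K k B).filter (fun 𝔡 => ∀ i, A i ∣ 𝔡 i),
          ∑ 𝔯 ∈ (box K k B).filter (fun 𝔯 => ∀ i, 𝔡 i ∣ 𝔯 i),
            (∏ i, (idealMoebius (𝔡 i) : ℝ)) * (y 𝔯 / ∏ i, idealTotient K (𝔯 i))
        = ∑ 𝔡 ∈ box K k B, ∑ 𝔯 ∈ box K k B, (if (∀ i, A i ∣ 𝔡 i) ∧ (∀ i, 𝔡 i ∣ 𝔯 i) then
            (∏ i, (idealMoebius (𝔡 i) : ℝ)) * (y 𝔯 / ∏ i, idealTotient K (𝔯 i)) else 0) := by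
          rw [Finset.sum_filter]
          refine Finset.sum_congr rfl fun 𝔡 _ => ?_
          rw [Finset.sum_filter]
          split_ifs with h1
          · refine Finset.sum_congr rfl fun 𝔯 _ => ?_
            by_cases h2 : ∀ i, 𝔡 i ∣ 𝔯 i
            · rw [if_pos h2, if_pos ⟨h1, h2⟩]
            · rw [if_neg h2, if_neg (fun h => h2 h.2)]
          · symm
            refine Finset.sum_eq_zero fun 𝔯 _ => ?_
            rw [if_neg (fun h => h1 h.1)]
      _ = ∑ 𝔯 ∈ box K k B, ∑ 𝔡 ∈ box K k B, (if (∀ i, A i ∣ 𝔡 i) ∧ (∀ i, 𝔡 i ∣ 𝔯 i) then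
            (∏ i, (idealMoebius (𝔡 i) : ℝ)) * (y 𝔯 / ∏ i, idealTotient K (𝔯 i)) else 0) :=
          Finset.sum_comm
      _ = _ := by
          refine Finset.sum_congr rfl fun 𝔯 _ => ?_
          rw [Finset.mul_sum, Finset.sum_filter]
          refine Finset.sum_congr rfl fun 𝔡 _ => ?_
          split_ifs <;> ring
  rw [step2]
  -- Step 3: the inner sum is `(∏ μ(Aᵢ)) [𝔯 = A]` whenever `y 𝔯 ≠ 0`.
  have step3 : ∀ 𝔯 ∈ box K k B, (y 𝔯 / ∏ i, idealTotient K (𝔯 i)) *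
      ∑ 𝔡 ∈ (box K k B).filter (fun 𝔡 => (∀ i, A i ∣ 𝔡 i) ∧ ∀ i, 𝔡 i ∣ 𝔯 i),
        ∏ i, (idealMoebius (𝔡 i) : ℝ) =
      if 𝔯 = A then (∏ i, (idealMoebius (A i) : ℝ)) * y A / ∏ i, idealTotient K (A i) else 0 := by
    intro 𝔯 hr
    by_cases hy0 : y 𝔯 = 0
    · rw [hy0, zero_div, zero_mul]
      split_ifs with h
      · subst h; rw [hy0, mul_zero, zero_div]
      · rfl
    have hgood := (hy 𝔯 hy0).2
    rw [filter_box_dvd_dvd_eq A 𝔯,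
      (Finset.prod_univ_sum (fun i => ((idealsLE K B).filter (· ∣ 𝔯 i)).filter (A i ∣ ·))
        (fun _ 𝔫 => (idealMoebius 𝔫 : ℝ))).symm]
    have hinner : ∀ i, ∑ 𝔡 ∈ ((idealsLE K B).filter (· ∣ 𝔯 i)).filter (A i ∣ ·), (idealMoebius 𝔡 : ℝ) =
        if 𝔯 i = A i then (idealMoebius (A i) : ℝ) else 0 := by
      intro i
      have h := sum_idealMoebius_filter_dvd_of_squarefree (hgood.squarefree_apply i) (A i)
        (mem_filter_dvd_iff_of_mem_box hr i)
      have h' := congrArg (fun z : ℤ => (z : ℝ)) h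
      simp only [Int.cast_sum] at h'
      rw [h']
      split_ifs <;> simp
    simp_rw [hinner]
    by_cases hrA : 𝔯 = A
    · rw [if_pos hrA]
      have hprod : (∏ i, (if 𝔯 i = A i then (idealMoebius (A i) : ℝ) else 0)) =
          ∏ i, (idealMoebius (A i) : ℝ) := by
        refine Finset.prod_congr rfl fun i _ => ?_
        rw [if_pos (congrFun hrA i)]
      rw [hprod, hrA]
      ring
    · rw [if_neg hrA]
      obtain ⟨i, hi⟩ := Function.ne_iff.1 hrA
      have hzero : (∏ i, (if 𝔯 i = A i then (idealMoebius (A i) : ℝ) else 0)) = 0 := by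
        apply Finset.prod_eq_zero (Finset.mem_univ i)
        rw [if_neg hi]
      rw [hzero, mul_zero]
  rw [Finset.sum_congr rfl step3, Finset.sum_ite_eq']
  split_ifs with hA
  · rfl
  · -- `A ∉ box`: then `y A = 0`
    have : y A = 0 := by
      by_contra h
      exact hA (hy A h).1
    rw [this, mul_zero, zero_div]

end Literature.NumberTheory.Sieve.MaynardNF

namespace Literature.NumberTheory.Sieve.MaynardNF

open UniqueFactorizationMonoid Literature.NumberTheory.LFunctions
  Literature.NumberTheory.LFunctions.NumberField

variable {K : Type*} [Field K] [NumberField K]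
variable {k : ℕ}

/-! ### The bilinear forms of Lemmas 5.1 and 5.2 over `𝓞_K`

We treat `∑'_{𝔡,𝔢} Λ_𝔡 Λ_𝔢/∏ᵢ ψ([𝔡ᵢ,𝔢ᵢ])` (pairs with `(𝔡ᵢ, 𝔢ⱼ) = 1` for `i ≠ j`; `[·,·] = ⊓`,
`(·,·) = ⊔` on ideals) for a coprime-multiplicative `ψ` with `ψ(𝔫) = ∑_{𝔲∣𝔫} ρ(𝔲)` on the good
scalars: `(ψ, ρ) = (N, φ)` is the main term of `S₁`, `(ψ, ρ) = (φ, g)` that of `S₂^{(m)}`. -/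

section Bilinear

/-- Off-diagonal index pairs `(i, j)`, `i ≠ j` (the indices of the variables `𝔰_{i,j}`). [folklore] -/
abbrev OffDiag (k : ℕ) := {p : Fin k × Fin k // p.1 ≠ p.2}

variable (K) in
/-- The good scalars: nonzero square-free ideals of norm `≤ B` comaximal with `𝔴`. [folklore] -/
def G1 (𝔴 : Ideal (𝓞 K)) (B : ℝ) : Finset (Ideal (𝓞 K)) :=
  (idealsLE K B).filter fun 𝔫 => Squarefree 𝔫 ∧ 𝔫 ⊔ 𝔴 = ⊤

/-- Membership in `G1`. [folklore] -/
theorem mem_G1 {𝔴 : Ideal (𝓞 K)} {B : ℝ} {𝔫 : Ideal (𝓞 K)} :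
    𝔫 ∈ G1 K 𝔴 B ↔ (𝔫 ≠ ⊥ ∧ (Ideal.absNorm 𝔫 : ℝ) ≤ B) ∧ Squarefree 𝔫 ∧ 𝔫 ⊔ 𝔴 = ⊤ := by
  simp [G1, mem_idealsLE]

variable (K) in
/-- The good tuples of the box. [folklore] -/
def boxG (k : ℕ) (𝔴 : Ideal (𝓞 K)) (B : ℝ) : Finset (Fin k → Ideal (𝓞 K)) :=
  (box K k B).filter (IsGood 𝔴)

/-- Membership in `boxG`. [folklore] -/
theorem mem_boxG {𝔴 : Ideal (𝓞 K)} {B : ℝ} {𝔯 : Fin k → Ideal (𝓞 K)} :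
    𝔯 ∈ boxG K k 𝔴 B ↔ 𝔯 ∈ box K k B ∧ IsGood 𝔴 𝔯 := by
  simp [boxG]

/-- Entries of good tuples of the box are good scalars. [folklore] -/
theorem apply_mem_G1_of_mem_boxG {𝔴 : Ideal (𝓞 K)} {B : ℝ} {𝔯 : Fin k → Ideal (𝓞 K)}
    (hr : 𝔯 ∈ boxG K k 𝔴 B) (i : Fin k) : 𝔯 i ∈ G1 K 𝔴 B := by
  rw [mem_boxG, mem_box_iff] at hr
  exact mem_G1.2 ⟨hr.1 i, hr.2.squarefree_apply i, hr.2.sup_eq_top_apply i⟩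

/-- Good tuples of the box lie in the product of the good scalars. [folklore] -/
theorem boxG_subset_piFinset (k : ℕ) (𝔴 : Ideal (𝓞 K)) (B : ℝ) :
    boxG K k 𝔴 B ⊆ Fintype.piFinset fun _ : Fin k => G1 K 𝔴 B := fun _ hr =>
  Fintype.mem_piFinset.2 (apply_mem_G1_of_mem_boxG hr)

variable (K) in
/-- The box of off-diagonal families of good scalars (the range of the `𝔰_{i,j}`). [folklore] -/
def sboxG (k : ℕ) (𝔴 : Ideal (𝓞 K)) (B : ℝ) : Finset (OffDiag k → Ideal (𝓞 K)) :=
  Fintype.piFinset fun _ => G1 K 𝔴 B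

variable (𝔴 : Ideal (𝓞 K)) (B : ℝ) (ψ ρ : Ideal (𝓞 K) → ℝ) (cf : (Fin k → Ideal (𝓞 K)) → ℝ)

variable (K) in
/-- `S(A) = ∑_{𝔡 good, Aᵢ ∣ 𝔡ᵢ} Λ_𝔡/∏ ψ(𝔡ᵢ)` for coefficients `Λ = cf`. [folklore] -/
def Ssum (A : Fin k → Ideal (𝓞 K)) : ℝ :=
  ∑ 𝔡 ∈ (boxG K k 𝔴 B).filter (fun 𝔡 => ∀ i, A i ∣ 𝔡 i), cf 𝔡 / ∏ i, ψ (𝔡 i)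

variable (K) in
/-- The diagonal variable attached to `Λ` and `(ψ, ρ)`:
`Y_A = (∏ μ(Aᵢ) ρ(Aᵢ)) ∑_{Aᵢ ∣ 𝔡ᵢ} Λ_𝔡/∏ ψ(𝔡ᵢ)` (Maynard's `y` for `(ψ,ρ) = (N, φ)`, `y^{(m)}` for
`(φ, g)`). [cite: CastilloEtAl2015, §2.2] -/
def Yv (A : Fin k → Ideal (𝓞 K)) : ℝ :=
  (∏ i, (idealMoebius (A i) : ℝ) * ρ (A i)) * Ssum K 𝔴 B ψ cf A

variable {𝔴 B ψ ρ cf}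

/-- The row tuple `Aᵢ = [𝔲ᵢ, [𝔰_{i,j}]_j]` (`lcm = ⊓` on ideals; Maynard's `a_j = u_j ∏_{i≠j} s_{j,i}`).
[cite: CastilloEtAl2015, §2.2] -/
def rowT (𝔲 : Fin k → Ideal (𝓞 K)) (𝔰 : OffDiag k → Ideal (𝓞 K)) : Fin k → Ideal (𝓞 K) := fun i =>
  𝔲 i ⊓ (Finset.univ.filter fun p : OffDiag k => p.1.1 = i).inf 𝔰

/-- The column tuple `Bⱼ = [𝔲ⱼ, [𝔰_{i,j}]_i]`. [cite: CastilloEtAl2015, §2.2] -/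
def colT (𝔲 : Fin k → Ideal (𝓞 K)) (𝔰 : OffDiag k → Ideal (𝓞 K)) : Fin k → Ideal (𝓞 K) := fun j =>
  𝔲 j ⊓ (Finset.univ.filter fun p : OffDiag k => p.1.2 = j).inf 𝔰

/-- `𝔞 ⊓ 𝔟 ∣ 𝔠 ↔ 𝔞 ∣ 𝔠 ∧ 𝔟 ∣ 𝔠` for ideals of a Dedekind domain (`∣ = ≥`). [folklore] -/
theorem inf_dvd_iff {𝔞 𝔟 𝔠 : Ideal (𝓞 K)} : 𝔞 ⊓ 𝔟 ∣ 𝔠 ↔ 𝔞 ∣ 𝔠 ∧ 𝔟 ∣ 𝔠 := by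
  simp only [Ideal.dvd_iff_le, le_inf_iff]

/-- `t.inf 𝔰 ∣ 𝔠 ↔ ∀ p ∈ t, 𝔰 p ∣ 𝔠`. [folklore] -/
theorem finsetInf_dvd_iff {ι : Type*} {t : Finset ι} {𝔰 : ι → Ideal (𝓞 K)} {𝔠 : Ideal (𝓞 K)} :
    t.inf 𝔰 ∣ 𝔠 ↔ ∀ p ∈ t, 𝔰 p ∣ 𝔠 := by
  simp only [Ideal.dvd_iff_le, Finset.le_inf_iff]

/-- `Aᵢ ∣ 𝔡ᵢ` for all `i` iff `𝔲ᵢ ∣ 𝔡ᵢ` for all `i` and `𝔰_p ∣ 𝔡_{p.1}` for all `p`. [folklore] -/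
theorem rowT_dvd_iff (𝔲 𝔡 : Fin k → Ideal (𝓞 K)) (𝔰 : OffDiag k → Ideal (𝓞 K)) :
    (∀ i, rowT 𝔲 𝔰 i ∣ 𝔡 i) ↔ (∀ i, 𝔲 i ∣ 𝔡 i) ∧ ∀ p : OffDiag k, 𝔰 p ∣ 𝔡 p.1.1 := by
  simp only [rowT, inf_dvd_iff, finsetInf_dvd_iff, Finset.mem_filter, Finset.mem_univ, true_and]
  constructor
  · intro h
    exact ⟨fun i => (h i).1, fun p => (h p.1.1).2 p rfl⟩
  · rintro ⟨h1, h2⟩ i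
    exact ⟨h1 i, fun p hp => hp ▸ h2 p⟩

/-- `Bⱼ ∣ 𝔢ⱼ` for all `j` iff `𝔲ⱼ ∣ 𝔢ⱼ` for all `j` and `𝔰_p ∣ 𝔢_{p.2}` for all `p`. [folklore] -/
theorem colT_dvd_iff (𝔲 𝔢 : Fin k → Ideal (𝓞 K)) (𝔰 : OffDiag k → Ideal (𝓞 K)) :
    (∀ j, colT 𝔲 𝔰 j ∣ 𝔢 j) ↔ (∀ j, 𝔲 j ∣ 𝔢 j) ∧ ∀ p : OffDiag k, 𝔰 p ∣ 𝔢 p.1.2 := by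
  simp only [colT, inf_dvd_iff, finsetInf_dvd_iff, Finset.mem_filter, Finset.mem_univ, true_and]
  constructor
  · intro h
    exact ⟨fun i => (h i).1, fun p => (h p.1.2).2 p rfl⟩
  · rintro ⟨h1, h2⟩ i
    exact ⟨h1 i, fun p hp => hp ▸ h2 p⟩

/-- Divisors of good scalars are good scalars. [folklore] -/
theorem mem_G1_of_dvd {𝔴 : Ideal (𝓞 K)} {B : ℝ} {𝔞 𝔫 : Ideal (𝓞 K)} (hn : 𝔫 ∈ G1 K 𝔴 B)
    (ha : 𝔞 ∣ 𝔫) : 𝔞 ∈ G1 K 𝔴 B := by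
  rw [mem_G1] at hn ⊢
  have hn0 : 𝔫 ≠ ⊥ := hn.1.1
  have ha0 : 𝔞 ≠ ⊥ := by
    rintro rfl; rw [Ideal.dvd_iff_le, le_bot_iff] at ha; exact hn0 ha
  have hN : Ideal.absNorm 𝔫 ≠ 0 := by rwa [Ne, Ideal.absNorm_eq_zero_iff]
  refine ⟨⟨ha0, le_trans ?_ hn.1.2⟩, hn.2.1.squarefree_of_dvd ha, sup_eq_top_of_dvd ha hn.2.2⟩
  exact_mod_cast Nat.le_of_dvd (Nat.pos_of_ne_zero hN) (map_dvd _ ha)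

section Hyps

variable {𝔴 : Ideal (𝓞 K)} {B : ℝ} {ψ ρ : Ideal (𝓞 K) → ℝ}

/-- **`ψ([𝔞,𝔟]) ψ((𝔞,𝔟)) = ψ(𝔞) ψ(𝔟)`** for square-free `𝔞, 𝔟` and a coprime-multiplicative `ψ`:
write `𝔞 = 𝔤𝔞'`, `𝔟 = 𝔤𝔟'` with `𝔤 = 𝔞 + 𝔟`; then `𝔤, 𝔞', 𝔟'` are pairwise comaximal and
`𝔞 ∩ 𝔟 = 𝔤𝔞'𝔟'` (`(𝔞 + 𝔟)(𝔞 ∩ 𝔟) = 𝔞𝔟`, Mathlib's `Ideal.sup_mul_inf`). [folklore] -/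
theorem psi_inf_mul_psi_sup (hψ : ∀ 𝔞 𝔟 : Ideal (𝓞 K), 𝔞 ⊔ 𝔟 = ⊤ → ψ (𝔞 * 𝔟) = ψ 𝔞 * ψ 𝔟)
    {𝔞 𝔟 : Ideal (𝓞 K)} (ha : Squarefree 𝔞) (hb : Squarefree 𝔟) :
    ψ (𝔞 ⊓ 𝔟) * ψ (𝔞 ⊔ 𝔟) = ψ 𝔞 * ψ 𝔟 := by
  set 𝔤 := 𝔞 ⊔ 𝔟 with hg
  have ha0 : 𝔞 ≠ 0 := ha.ne_zero
  have hg0 : 𝔤 ≠ 0 := by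
    intro h0
    rw [Ideal.zero_eq_bot] at h0
    exact ha0 (by rw [Ideal.zero_eq_bot]; exact le_bot_iff.1 (h0 ▸ (le_sup_left : 𝔞 ≤ 𝔤)))
  obtain ⟨𝔞', ha'⟩ : 𝔤 ∣ 𝔞 := Ideal.dvd_iff_le.2 le_sup_left
  obtain ⟨𝔟', hb'⟩ : 𝔤 ∣ 𝔟 := Ideal.dvd_iff_le.2 le_sup_right
  have hga : 𝔤 ⊔ 𝔞' = ⊤ :=
    sup_eq_top_of_squarefree_mul (𝔯 := 𝔤) (𝔪 := 𝔞') (by rw [← ha']; exact ha)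
  have hgb : 𝔤 ⊔ 𝔟' = ⊤ :=
    sup_eq_top_of_squarefree_mul (𝔯 := 𝔤) (𝔪 := 𝔟') (by rw [← hb']; exact hb)
  -- `𝔞' + 𝔟' = (1)`
  have hab' : 𝔞' ⊔ 𝔟' = ⊤ := by
    by_contra hne
    obtain ⟨M, hM, hle⟩ := Ideal.exists_le_maximal _ hne
    have hMa' : 𝔞' ≤ M := le_sup_left.trans hle
    have hMb' : 𝔟' ≤ M := le_sup_right.trans hle
    have hMa : 𝔞 ≤ M := by rw [ha']; exact Ideal.mul_le_left.trans hMa'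
    have hMb : 𝔟 ≤ M := by rw [hb']; exact Ideal.mul_le_left.trans hMb'
    have hMg : 𝔤 ≤ M := sup_le hMa hMb
    have : 𝔤 ⊔ 𝔞' ≤ M := sup_le hMg hMa'
    rw [hga, top_le_iff] at this
    exact hM.ne_top this
  -- `𝔞 ∩ 𝔟 = 𝔞' 𝔟` and `𝔞' + 𝔟 = (1)`
  have hinf : 𝔞 ⊓ 𝔟 = 𝔞' * 𝔟 := by
    have h := Ideal.sup_mul_inf 𝔞 𝔟
    rw [← hg] at h
    have h2 : 𝔤 * (𝔞 ⊓ 𝔟) = 𝔤 * (𝔞' * 𝔟) := by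
      rw [h, ha']; ring
    exact mul_left_cancel₀ hg0 h2
  have ha'b : 𝔞' ⊔ 𝔟 = ⊤ := by
    rw [hb', sup_comm, mul_sup_eq_top_iff]
    exact ⟨hga, by rwa [sup_comm] at hab'⟩
  rw [hinf, hψ _ _ ha'b, ha', hψ _ _ hga]
  ring

/-- The local identity `1/ψ([𝔞,𝔟]) = (∑_{𝔲 ∣ (𝔞,𝔟)} ρ(𝔲))/(ψ(𝔞)ψ(𝔟))` (Maynard (5.5)/(5.22) over
ideals). [cite: CastilloEtAl2015, §2.2] -/
theorem inv_psi_lcm_eq (hψ : ∀ 𝔞 𝔟 : Ideal (𝓞 K), 𝔞 ⊔ 𝔟 = ⊤ → ψ (𝔞 * 𝔟) = ψ 𝔞 * ψ 𝔟)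
    (hρψ : ∀ 𝔫 ∈ G1 K 𝔴 B, ∑ 𝔲 ∈ idealDivisors K 𝔫, ρ 𝔲 = ψ 𝔫)
    (hψpos : ∀ 𝔫 ∈ G1 K 𝔴 B, 0 < ψ 𝔫) {𝔞 𝔟 : Ideal (𝓞 K)} (ha : 𝔞 ∈ G1 K 𝔴 B) (hb : 𝔟 ∈ G1 K 𝔴 B) :
    1 / ψ (𝔞 ⊓ 𝔟) = (∑ 𝔲 ∈ idealDivisors K (𝔞 ⊔ 𝔟), ρ 𝔲) / (ψ 𝔞 * ψ 𝔟) := by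
  have hg : 𝔞 ⊔ 𝔟 ∈ G1 K 𝔴 B := mem_G1_of_dvd ha (Ideal.dvd_iff_le.2 le_sup_left)
  have hmul := psi_inf_mul_psi_sup hψ (mem_G1.1 ha).2.1 (mem_G1.1 hb).2.1
  have hgpos := hψpos _ hg
  have hapos := hψpos _ ha
  have hbpos := hψpos _ hb
  have hl : ψ (𝔞 ⊓ 𝔟) ≠ 0 := fun h => by
    rw [h, zero_mul] at hmul; linarith [mul_pos hapos hbpos]
  rw [hρψ _ hg, div_eq_div_iff hl (by positivity), one_mul, ← hmul]
  ring

/-- `[(𝔞, 𝔟) = 1] = ∑_{𝔰 ∣ (𝔞,𝔟)} μ(𝔰)` (`𝔞 ≠ 0`). [folklore] -/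
theorem ite_coprime_eq_sum_moebius {𝔞 : Ideal (𝓞 K)} (ha : 𝔞 ≠ ⊥) (𝔟 : Ideal (𝓞 K)) :
    (if 𝔞 ⊔ 𝔟 = ⊤ then (1 : ℝ) else 0) = ∑ 𝔰 ∈ idealDivisors K (𝔞 ⊔ 𝔟), (idealMoebius 𝔰 : ℝ) := by
  have hJ : 𝔞 ⊔ 𝔟 ≠ ⊥ := fun h => ha (le_bot_iff.1 (h ▸ le_sup_left))
  have h := sum_idealMoebius_of_dvd hJ (fun B => mem_idealDivisors hJ)
  have h' := congrArg (fun z : ℤ => (z : ℝ)) h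
  simp only [Int.cast_sum] at h'
  rw [h']
  split_ifs <;> simp

/-- The row divisibility condition attached to `(𝔲, 𝔰)`. [folklore] -/
def RowCond (𝔲 : Fin k → Ideal (𝓞 K)) (𝔰 : OffDiag k → Ideal (𝓞 K)) (𝔡 : Fin k → Ideal (𝓞 K)) : Prop :=
  (∀ i, 𝔲 i ∣ 𝔡 i) ∧ ∀ p : OffDiag k, 𝔰 p ∣ 𝔡 p.1.1

/-- The column divisibility condition attached to `(𝔲, 𝔰)`. [folklore] -/
def ColCond (𝔲 : Fin k → Ideal (𝓞 K)) (𝔰 : OffDiag k → Ideal (𝓞 K)) (𝔢 : Fin k → Ideal (𝓞 K)) : Prop :=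
  (∀ j, 𝔲 j ∣ 𝔢 j) ∧ ∀ p : OffDiag k, 𝔰 p ∣ 𝔢 p.1.2

/-- The `𝔲`-range: tuples dividing `(𝔡ᵢ, 𝔢ᵢ)` entrywise are exactly the good tuples with
`𝔲ᵢ ∣ 𝔡ᵢ`, `𝔲ᵢ ∣ 𝔢ᵢ`. [folklore] -/
theorem piFinset_gcd_divisors_eq {𝔡 𝔢 : Fin k → Ideal (𝓞 K)} (hd : 𝔡 ∈ boxG K k 𝔴 B) :
    (Fintype.piFinset fun i => idealDivisors K (𝔡 i ⊔ 𝔢 i)) =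
      (boxG K k 𝔴 B).filter fun 𝔲 => ∀ i, 𝔲 i ∣ 𝔡 i ∧ 𝔲 i ∣ 𝔢 i := by
  have hd' := hd
  rw [mem_boxG, mem_box_iff] at hd'
  have hJ : ∀ i, 𝔡 i ⊔ 𝔢 i ≠ ⊥ := fun i h => (hd'.1 i).1 (le_bot_iff.1 (h ▸ le_sup_left))
  ext 𝔲
  simp only [Fintype.mem_piFinset, Finset.mem_filter]
  constructor
  · intro h
    have hdiv : ∀ i, 𝔲 i ∣ 𝔡 i ∧ 𝔲 i ∣ 𝔢 i := fun i =>
      dvd_and_dvd_iff_dvd_sup.2 ((mem_idealDivisors (hJ i)).1 (h i))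
    refine ⟨?_, hdiv⟩
    rw [mem_boxG, mem_box_iff]
    refine ⟨fun i => ⟨?_, ?_⟩, hd'.2.of_dvd fun i => (hdiv i).1⟩
    · intro h0
      have := (hdiv i).1
      rw [h0, Ideal.dvd_iff_le, le_bot_iff] at this
      exact (hd'.1 i).1 this
    · have hN : Ideal.absNorm (𝔡 i) ≠ 0 := by rw [Ne, Ideal.absNorm_eq_zero_iff]; exact (hd'.1 i).1
      exact le_trans (by exact_mod_cast Nat.le_of_dvd (Nat.pos_of_ne_zero hN) (map_dvd _ (hdiv i).1))
        (hd'.1 i).2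
  · rintro ⟨-, h⟩ i
    exact (mem_idealDivisors (hJ i)).2 (dvd_and_dvd_iff_dvd_sup.1 (h i))

/-- The `𝔰`-range: families dividing `(𝔡_{p.1}, 𝔢_{p.2})` are exactly the families of good scalars
with `𝔰_p ∣ 𝔡_{p.1}`, `𝔰_p ∣ 𝔢_{p.2}`. [folklore] -/
theorem piFinset_gcd_divisors_eq' {𝔡 𝔢 : Fin k → Ideal (𝓞 K)} (hd : 𝔡 ∈ boxG K k 𝔴 B) :
    (Fintype.piFinset fun p : OffDiag k => idealDivisors K (𝔡 p.1.1 ⊔ 𝔢 p.1.2)) =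
      (sboxG K k 𝔴 B).filter fun 𝔰 => ∀ p, 𝔰 p ∣ 𝔡 p.1.1 ∧ 𝔰 p ∣ 𝔢 p.1.2 := by
  have hd' := hd
  rw [mem_boxG, mem_box_iff] at hd'
  have hJ : ∀ p : OffDiag k, 𝔡 p.1.1 ⊔ 𝔢 p.1.2 ≠ ⊥ := fun p h =>
    (hd'.1 p.1.1).1 (le_bot_iff.1 (h ▸ le_sup_left))
  ext 𝔰
  simp only [Fintype.mem_piFinset, Finset.mem_filter, sboxG]
  constructor
  · intro h
    have hdiv : ∀ p, 𝔰 p ∣ 𝔡 p.1.1 ∧ 𝔰 p ∣ 𝔢 p.1.2 := fun p =>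
      dvd_and_dvd_iff_dvd_sup.2 ((mem_idealDivisors (hJ p)).1 (h p))
    exact ⟨fun p => mem_G1_of_dvd (apply_mem_G1_of_mem_boxG hd p.1.1) (hdiv p).1, hdiv⟩
  · rintro ⟨-, h⟩ p
    exact (mem_idealDivisors (hJ p)).2 (dvd_and_dvd_iff_dvd_sup.1 (h p))

/-- **Expansion of one term of the bilinear form** (Maynard (5.5)–(5.7) over ideals): for good
`𝔡, 𝔢`, `[(𝔡ᵢ,𝔢ⱼ)=1 ∀ i≠j] Λ_𝔡Λ_𝔢/∏ψ([𝔡ᵢ,𝔢ᵢ]) = ∑_{𝔲,𝔰} [rows] [columns] ∏ρ(𝔲ᵢ) ∏μ(𝔰_p)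
(Λ_𝔡/∏ψ(𝔡ᵢ)) (Λ_𝔢/∏ψ(𝔢ᵢ))`. [cite: CastilloEtAl2015, §2.2] -/
theorem term_expand (hψ : ∀ 𝔞 𝔟 : Ideal (𝓞 K), 𝔞 ⊔ 𝔟 = ⊤ → ψ (𝔞 * 𝔟) = ψ 𝔞 * ψ 𝔟)
    (hρψ : ∀ 𝔫 ∈ G1 K 𝔴 B, ∑ 𝔲 ∈ idealDivisors K 𝔫, ρ 𝔲 = ψ 𝔫)
    (hψpos : ∀ 𝔫 ∈ G1 K 𝔴 B, 0 < ψ 𝔫)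
    (cf : (Fin k → Ideal (𝓞 K)) → ℝ) {𝔡 𝔢 : Fin k → Ideal (𝓞 K)} (hd : 𝔡 ∈ boxG K k 𝔴 B)
    (he : 𝔢 ∈ boxG K k 𝔴 B) :
    (if ∀ p : OffDiag k, 𝔡 p.1.1 ⊔ 𝔢 p.1.2 = ⊤ then
        cf 𝔡 * cf 𝔢 / ∏ i, ψ (𝔡 i ⊓ 𝔢 i) else 0) =
      ∑ 𝔲 ∈ boxG K k 𝔴 B, ∑ 𝔰 ∈ sboxG K k 𝔴 B,
        if RowCond 𝔲 𝔰 𝔡 ∧ ColCond 𝔲 𝔰 𝔢 then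
          (∏ i, ρ (𝔲 i)) * (∏ p, (idealMoebius (𝔰 p) : ℝ)) * (cf 𝔡 / ∏ i, ψ (𝔡 i)) *
            (cf 𝔢 / ∏ i, ψ (𝔢 i))
        else 0 := by
  -- (A) the `ψ`-part
  have hdG := apply_mem_G1_of_mem_boxG hd
  have heG := apply_mem_G1_of_mem_boxG he
  have hd0 : ∀ i, 𝔡 i ≠ ⊥ := fun i => (mem_G1.1 (hdG i)).1.1
  have hA : (1 : ℝ) / ∏ i, ψ (𝔡 i ⊓ 𝔢 i) =
      (∑ 𝔲 ∈ Fintype.piFinset fun i => idealDivisors K (𝔡 i ⊔ 𝔢 i), ∏ i, ρ (𝔲 i)) /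
        ((∏ i, ψ (𝔡 i)) * ∏ i, ψ (𝔢 i)) := by
    rw [← Finset.prod_univ_sum, ← Finset.prod_mul_distrib, ← Finset.prod_div_distrib,
      one_div, ← Finset.prod_inv_distrib]
    refine Finset.prod_congr rfl fun i _ => ?_
    rw [← one_div]
    exact inv_psi_lcm_eq hψ hρψ hψpos (hdG i) (heG i)
  -- (B) the coprimality indicator
  have hB : (if ∀ p : OffDiag k, 𝔡 p.1.1 ⊔ 𝔢 p.1.2 = ⊤ then (1 : ℝ) else 0) =
      ∑ 𝔰 ∈ Fintype.piFinset fun p : OffDiag k => idealDivisors K (𝔡 p.1.1 ⊔ 𝔢 p.1.2),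
        ∏ p, (idealMoebius (𝔰 p) : ℝ) := by
    rw [← Finset.prod_univ_sum (fun p : OffDiag k => idealDivisors K (𝔡 p.1.1 ⊔ 𝔢 p.1.2))
      (fun _ 𝔫 => (idealMoebius 𝔫 : ℝ))]
    simp_rw [← ite_coprime_eq_sum_moebius (hd0 _)]
    rw [Finset.prod_boole]
    simp
  -- combine
  have hψd : 0 < ∏ i, ψ (𝔡 i) := Finset.prod_pos fun i _ => hψpos _ (hdG i)
  have hψe : 0 < ∏ i, ψ (𝔢 i) := Finset.prod_pos fun i _ => hψpos _ (heG i)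
  calc (if ∀ p : OffDiag k, 𝔡 p.1.1 ⊔ 𝔢 p.1.2 = ⊤ then
          cf 𝔡 * cf 𝔢 / ∏ i, ψ (𝔡 i ⊓ 𝔢 i) else 0)
      = (if ∀ p : OffDiag k, 𝔡 p.1.1 ⊔ 𝔢 p.1.2 = ⊤ then (1 : ℝ) else 0) *
          (cf 𝔡 * cf 𝔢 * (1 / ∏ i, ψ (𝔡 i ⊓ 𝔢 i))) := by
        split_ifs <;> ring
    _ = (∑ 𝔰 ∈ (sboxG K k 𝔴 B).filter (fun 𝔰 => ∀ p, 𝔰 p ∣ 𝔡 p.1.1 ∧ 𝔰 p ∣ 𝔢 p.1.2),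
          ∏ p, (idealMoebius (𝔰 p) : ℝ)) *
          (cf 𝔡 * cf 𝔢 * ((∑ 𝔲 ∈ (boxG K k 𝔴 B).filter (fun 𝔲 => ∀ i, 𝔲 i ∣ 𝔡 i ∧ 𝔲 i ∣ 𝔢 i),
            ∏ i, ρ (𝔲 i)) / ((∏ i, ψ (𝔡 i)) * ∏ i, ψ (𝔢 i)))) := by
        rw [hB, hA, piFinset_gcd_divisors_eq hd, piFinset_gcd_divisors_eq' hd]
    _ = ∑ 𝔲 ∈ (boxG K k 𝔴 B).filter (fun 𝔲 => ∀ i, 𝔲 i ∣ 𝔡 i ∧ 𝔲 i ∣ 𝔢 i),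
          ∑ 𝔰 ∈ (sboxG K k 𝔴 B).filter (fun 𝔰 => ∀ p, 𝔰 p ∣ 𝔡 p.1.1 ∧ 𝔰 p ∣ 𝔢 p.1.2),
            (∏ i, ρ (𝔲 i)) * (∏ p, (idealMoebius (𝔰 p) : ℝ)) * (cf 𝔡 / ∏ i, ψ (𝔡 i)) *
              (cf 𝔢 / ∏ i, ψ (𝔢 i)) := by
        have hPd : (∏ i, ψ (𝔡 i)) ≠ 0 := hψd.ne'
        have hPe : (∏ i, ψ (𝔢 i)) ≠ 0 := hψe.ne'
        set U := ∑ 𝔲 ∈ (boxG K k 𝔴 B).filter (fun 𝔲 => ∀ i, 𝔲 i ∣ 𝔡 i ∧ 𝔲 i ∣ 𝔢 i), ∏ i, ρ (𝔲 i)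
          with hU
        set Sm := ∑ 𝔰 ∈ (sboxG K k 𝔴 B).filter (fun 𝔰 => ∀ p, 𝔰 p ∣ 𝔡 p.1.1 ∧ 𝔰 p ∣ 𝔢 p.1.2),
          ∏ p, (idealMoebius (𝔰 p) : ℝ) with hSm
        have e1 : Sm * (cf 𝔡 * cf 𝔢 * (U / ((∏ i, ψ (𝔡 i)) * ∏ i, ψ (𝔢 i)))) =
            (U * Sm) * (cf 𝔡 / (∏ i, ψ (𝔡 i)) * (cf 𝔢 / ∏ i, ψ (𝔢 i))) := by
          simp only [div_eq_mul_inv, mul_inv]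
          ring
        rw [e1, hU, hSm, Finset.sum_mul_sum, Finset.sum_mul]
        refine Finset.sum_congr rfl fun 𝔲 _ => ?_
        rw [Finset.sum_mul]
        refine Finset.sum_congr rfl fun 𝔰 _ => ?_
        ring
    _ = _ := by
        rw [Finset.sum_filter]
        refine Finset.sum_congr rfl fun 𝔲 _ => ?_
        rw [Finset.sum_filter]
        split_ifs with hu
        · refine Finset.sum_congr rfl fun 𝔰 _ => ?_
          by_cases hs : ∀ p, 𝔰 p ∣ 𝔡 p.1.1 ∧ 𝔰 p ∣ 𝔢 p.1.2
          · rw [if_pos hs, if_pos]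
            exact ⟨⟨fun i => (hu i).1, fun p => (hs p).1⟩, fun j => (hu j).2, fun p => (hs p).2⟩
          · rw [if_neg hs, if_neg]
            rintro ⟨⟨-, h1⟩, -, h2⟩
            exact hs fun p => ⟨h1 p, h2 p⟩
        · symm
          refine Finset.sum_eq_zero fun 𝔰 _ => ?_
          rw [if_neg]
          rintro ⟨⟨h1, -⟩, h2, -⟩
          exact hu fun i => ⟨h1 i, h2 i⟩

/-- `∑_{𝔡 good, RowCond} Λ_𝔡/∏ψ(𝔡ᵢ) = S(A(𝔲,𝔰))`. [folklore] -/
theorem sum_ite_rowCond_eq (cf : (Fin k → Ideal (𝓞 K)) → ℝ) (𝔲 : Fin k → Ideal (𝓞 K))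
    (𝔰 : OffDiag k → Ideal (𝓞 K)) :
    ∑ 𝔡 ∈ boxG K k 𝔴 B, (if RowCond 𝔲 𝔰 𝔡 then cf 𝔡 / ∏ i, ψ (𝔡 i) else 0) =
      Ssum K 𝔴 B ψ cf (rowT 𝔲 𝔰) := by
  rw [Ssum, ← Finset.sum_filter]
  refine Finset.sum_congr ?_ fun _ _ => rfl
  ext 𝔡
  simp only [Finset.mem_filter, RowCond, rowT_dvd_iff]

/-- `∑_{𝔢 good, ColCond} Λ_𝔢/∏ψ(𝔢ᵢ) = S(B(𝔲,𝔰))`. [folklore] -/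
theorem sum_ite_colCond_eq (cf : (Fin k → Ideal (𝓞 K)) → ℝ) (𝔲 : Fin k → Ideal (𝓞 K))
    (𝔰 : OffDiag k → Ideal (𝓞 K)) :
    ∑ 𝔢 ∈ boxG K k 𝔴 B, (if ColCond 𝔲 𝔰 𝔢 then cf 𝔢 / ∏ i, ψ (𝔢 i) else 0) =
      Ssum K 𝔴 B ψ cf (colT 𝔲 𝔰) := by
  rw [Ssum, ← Finset.sum_filter]
  refine Finset.sum_congr ?_ fun _ _ => rfl
  ext 𝔢
  simp only [Finset.mem_filter, ColCond, colT_dvd_iff]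

/-- **Rearrangement of the bilinear form** (Maynard (5.6)–(5.8) over ideals):
`∑'_{𝔡,𝔢} Λ_𝔡Λ_𝔢/∏ψ([𝔡ᵢ,𝔢ᵢ]) = ∑_{𝔲} ∑_{𝔰} ∏ρ(𝔲ᵢ) ∏μ(𝔰_{i,j}) S(A(𝔲,𝔰)) S(B(𝔲,𝔰))`.
[cite: CastilloEtAl2015, §2.2] -/
theorem bilinear_rearrange (hψ : ∀ 𝔞 𝔟 : Ideal (𝓞 K), 𝔞 ⊔ 𝔟 = ⊤ → ψ (𝔞 * 𝔟) = ψ 𝔞 * ψ 𝔟)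
    (hρψ : ∀ 𝔫 ∈ G1 K 𝔴 B, ∑ 𝔲 ∈ idealDivisors K 𝔫, ρ 𝔲 = ψ 𝔫)
    (hψpos : ∀ 𝔫 ∈ G1 K 𝔴 B, 0 < ψ 𝔫) (cf : (Fin k → Ideal (𝓞 K)) → ℝ) :
    ∑ 𝔡 ∈ boxG K k 𝔴 B, ∑ 𝔢 ∈ boxG K k 𝔴 B,
        (if ∀ p : OffDiag k, 𝔡 p.1.1 ⊔ 𝔢 p.1.2 = ⊤ then
          cf 𝔡 * cf 𝔢 / ∏ i, ψ (𝔡 i ⊓ 𝔢 i) else 0) =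
      ∑ 𝔲 ∈ boxG K k 𝔴 B, ∑ 𝔰 ∈ sboxG K k 𝔴 B,
        (∏ i, ρ (𝔲 i)) * (∏ p, (idealMoebius (𝔰 p) : ℝ)) *
          (Ssum K 𝔴 B ψ cf (rowT 𝔲 𝔰) * Ssum K 𝔴 B ψ cf (colT 𝔲 𝔰)) := by
  have hexp : ∑ 𝔡 ∈ boxG K k 𝔴 B, ∑ 𝔢 ∈ boxG K k 𝔴 B,
      (if ∀ p : OffDiag k, 𝔡 p.1.1 ⊔ 𝔢 p.1.2 = ⊤ then
        cf 𝔡 * cf 𝔢 / ∏ i, ψ (𝔡 i ⊓ 𝔢 i) else 0) =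
      ∑ 𝔡 ∈ boxG K k 𝔴 B, ∑ 𝔢 ∈ boxG K k 𝔴 B, ∑ 𝔲 ∈ boxG K k 𝔴 B, ∑ 𝔰 ∈ sboxG K k 𝔴 B,
        if RowCond 𝔲 𝔰 𝔡 ∧ ColCond 𝔲 𝔰 𝔢 then
          (∏ i, ρ (𝔲 i)) * (∏ p, (idealMoebius (𝔰 p) : ℝ)) * (cf 𝔡 / ∏ i, ψ (𝔡 i)) *
            (cf 𝔢 / ∏ i, ψ (𝔢 i))
        else 0 :=
    Finset.sum_congr rfl fun 𝔡 hd => Finset.sum_congr rfl fun 𝔢 he =>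
      term_expand hψ hρψ hψpos cf hd he
  rw [hexp]
  have hswap : ∑ 𝔡 ∈ boxG K k 𝔴 B, ∑ 𝔢 ∈ boxG K k 𝔴 B, ∑ 𝔲 ∈ boxG K k 𝔴 B, ∑ 𝔰 ∈ sboxG K k 𝔴 B,
      (if RowCond 𝔲 𝔰 𝔡 ∧ ColCond 𝔲 𝔰 𝔢 then
        (∏ i, ρ (𝔲 i)) * (∏ p, (idealMoebius (𝔰 p) : ℝ)) * (cf 𝔡 / ∏ i, ψ (𝔡 i)) *
          (cf 𝔢 / ∏ i, ψ (𝔢 i))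
        else 0) =
      ∑ 𝔲 ∈ boxG K k 𝔴 B, ∑ 𝔰 ∈ sboxG K k 𝔴 B, ∑ 𝔡 ∈ boxG K k 𝔴 B, ∑ 𝔢 ∈ boxG K k 𝔴 B,
      (if RowCond 𝔲 𝔰 𝔡 ∧ ColCond 𝔲 𝔰 𝔢 then
        (∏ i, ρ (𝔲 i)) * (∏ p, (idealMoebius (𝔰 p) : ℝ)) * (cf 𝔡 / ∏ i, ψ (𝔡 i)) *
          (cf 𝔢 / ∏ i, ψ (𝔢 i))
        else 0) := by
    calc _ = ∑ 𝔡 ∈ boxG K k 𝔴 B, ∑ 𝔲 ∈ boxG K k 𝔴 B, ∑ 𝔢 ∈ boxG K k 𝔴 B, ∑ 𝔰 ∈ sboxG K k 𝔴 B,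
          (if RowCond 𝔲 𝔰 𝔡 ∧ ColCond 𝔲 𝔰 𝔢 then
            (∏ i, ρ (𝔲 i)) * (∏ p, (idealMoebius (𝔰 p) : ℝ)) * (cf 𝔡 / ∏ i, ψ (𝔡 i)) *
              (cf 𝔢 / ∏ i, ψ (𝔢 i)) else 0) :=
          Finset.sum_congr rfl fun _ _ => Finset.sum_comm
      _ = ∑ 𝔲 ∈ boxG K k 𝔴 B, ∑ 𝔡 ∈ boxG K k 𝔴 B, ∑ 𝔢 ∈ boxG K k 𝔴 B, ∑ 𝔰 ∈ sboxG K k 𝔴 B,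
          (if RowCond 𝔲 𝔰 𝔡 ∧ ColCond 𝔲 𝔰 𝔢 then
            (∏ i, ρ (𝔲 i)) * (∏ p, (idealMoebius (𝔰 p) : ℝ)) * (cf 𝔡 / ∏ i, ψ (𝔡 i)) *
              (cf 𝔢 / ∏ i, ψ (𝔢 i)) else 0) := Finset.sum_comm
      _ = ∑ 𝔲 ∈ boxG K k 𝔴 B, ∑ 𝔡 ∈ boxG K k 𝔴 B, ∑ 𝔰 ∈ sboxG K k 𝔴 B, ∑ 𝔢 ∈ boxG K k 𝔴 B,
          (if RowCond 𝔲 𝔰 𝔡 ∧ ColCond 𝔲 𝔰 𝔢 then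
            (∏ i, ρ (𝔲 i)) * (∏ p, (idealMoebius (𝔰 p) : ℝ)) * (cf 𝔡 / ∏ i, ψ (𝔡 i)) *
              (cf 𝔢 / ∏ i, ψ (𝔢 i)) else 0) :=
          Finset.sum_congr rfl fun _ _ => Finset.sum_congr rfl fun _ _ => Finset.sum_comm
      _ = _ := Finset.sum_congr rfl fun _ _ => Finset.sum_comm
  rw [hswap]
  refine Finset.sum_congr rfl fun 𝔲 _ => Finset.sum_congr rfl fun 𝔰 _ => ?_
  have hfac : ∀ 𝔡 ∈ boxG K k 𝔴 B, ∀ 𝔢 ∈ boxG K k 𝔴 B,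
      (if RowCond 𝔲 𝔰 𝔡 ∧ ColCond 𝔲 𝔰 𝔢 then
        (∏ i, ρ (𝔲 i)) * (∏ p, (idealMoebius (𝔰 p) : ℝ)) * (cf 𝔡 / ∏ i, ψ (𝔡 i)) *
          (cf 𝔢 / ∏ i, ψ (𝔢 i))
        else 0) =
      (∏ i, ρ (𝔲 i)) * (∏ p, (idealMoebius (𝔰 p) : ℝ)) *
        ((if RowCond 𝔲 𝔰 𝔡 then cf 𝔡 / ∏ i, ψ (𝔡 i) else 0) *
          (if ColCond 𝔲 𝔰 𝔢 then cf 𝔢 / ∏ i, ψ (𝔢 i) else 0)) := by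
    intro 𝔡 _ 𝔢 _
    by_cases h1 : RowCond 𝔲 𝔰 𝔡 <;> by_cases h2 : ColCond 𝔲 𝔰 𝔢 <;> simp [h1, h2]
    ring
  rw [Finset.sum_congr rfl fun 𝔡 hd => Finset.sum_congr rfl fun 𝔢 he => hfac 𝔡 hd 𝔢 he]
  simp_rw [← Finset.mul_sum]
  rw [← Finset.sum_mul, sum_ite_rowCond_eq, sum_ite_colCond_eq]

end Hyps

end Bilinear

end Literature.NumberTheory.Sieve.MaynardNF

namespace Literature.NumberTheory.Sieve.MaynardNF

open UniqueFactorizationMonoid Literature.NumberTheory.LFunctions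
  Literature.NumberTheory.LFunctions.NumberField

variable {K : Type*} [Field K] [NumberField K]
variable {k : ℕ}

section Bilinear2

variable {𝔴 : Ideal (𝓞 K)} {B : ℝ} {ψ ρ : Ideal (𝓞 K) → ℝ}

/-! #### The diagonal (`𝔰 = (1)`) and the vanishing analysis for `𝔰 ≠ (1)` -/

/-- The trivial family `𝔰_{i,j} = (1)`. [folklore] -/
def oneFam (K : Type*) [Field K] [NumberField K] (k : ℕ) : OffDiag k → Ideal (𝓞 K) := fun _ => ⊤

/-- `(1)` is a good scalar as soon as `B ≥ 1`. [folklore] -/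
theorem top_mem_G1 (hB : 1 ≤ B) : (⊤ : Ideal (𝓞 K)) ∈ G1 K 𝔴 B := by
  rw [mem_G1]
  refine ⟨⟨top_ne_bot, ?_⟩, ?_, top_sup_eq _⟩
  · rw [Ideal.absNorm_top, Nat.cast_one]; exact hB
  · rw [← Ideal.one_eq_top]; exact squarefree_one

/-- `𝔰 = (1)` lies in the `𝔰`-box as soon as `B ≥ 1`. [folklore] -/
theorem oneFam_mem_sboxG (hB : 1 ≤ B) : oneFam K k ∈ sboxG K k 𝔴 B := by
  rw [sboxG, Fintype.mem_piFinset]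
  exact fun _ => top_mem_G1 hB

/-- An `inf` over a finset of the constant `(1)` is `(1)`. [folklore] -/
theorem inf_oneFam_eq (t : Finset (OffDiag k)) : t.inf (oneFam K k) = ⊤ :=
  top_le_iff.1 (Finset.le_inf fun _ _ => le_rfl)

/-- `A(𝔲, 1) = 𝔲`. [folklore] -/
theorem rowT_oneFam (𝔲 : Fin k → Ideal (𝓞 K)) : rowT 𝔲 (oneFam K k) = 𝔲 := by
  funext i; simp [rowT, inf_oneFam_eq]

/-- `B(𝔲, 1) = 𝔲`. [folklore] -/
theorem colT_oneFam (𝔲 : Fin k → Ideal (𝓞 K)) : colT 𝔲 (oneFam K k) = 𝔲 := by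
  funext i; simp [colT, inf_oneFam_eq]

/-- `𝔲ᵢ ∣ Aᵢ`. [folklore] -/
theorem dvd_rowT (𝔲 : Fin k → Ideal (𝓞 K)) (𝔰 : OffDiag k → Ideal (𝓞 K)) (i : Fin k) :
    𝔲 i ∣ rowT 𝔲 𝔰 i :=
  Ideal.dvd_iff_le.2 inf_le_left

/-- `𝔲ⱼ ∣ Bⱼ`. [folklore] -/
theorem dvd_colT (𝔲 : Fin k → Ideal (𝓞 K)) (𝔰 : OffDiag k → Ideal (𝓞 K)) (j : Fin k) :
    𝔲 j ∣ colT 𝔲 𝔰 j :=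
  Ideal.dvd_iff_le.2 inf_le_left

/-- `𝔰_p ∣ A_{p.1}`. [folklore] -/
theorem dvd_rowT' (𝔲 : Fin k → Ideal (𝓞 K)) (𝔰 : OffDiag k → Ideal (𝓞 K)) (p : OffDiag k) :
    𝔰 p ∣ rowT 𝔲 𝔰 p.1.1 :=
  Ideal.dvd_iff_le.2 (inf_le_right.trans
    (Finset.inf_le (Finset.mem_filter.2 ⟨Finset.mem_univ _, rfl⟩)))

/-- `𝔰_p ∣ B_{p.2}`. [folklore] -/
theorem dvd_colT' (𝔲 : Fin k → Ideal (𝓞 K)) (𝔰 : OffDiag k → Ideal (𝓞 K)) (p : OffDiag k) :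
    𝔰 p ∣ colT 𝔲 𝔰 p.1.2 :=
  Ideal.dvd_iff_le.2 (inf_le_right.trans
    (Finset.inf_le (Finset.mem_filter.2 ⟨Finset.mem_univ _, rfl⟩)))

omit [NumberField K] in
/-- Comaximality passes to divisors on both sides. [folklore] -/
theorem sup_eq_top_of_dvd_of_dvd {𝔞 𝔞₁ 𝔟 𝔟₁ : Ideal (𝓞 K)} (ha : 𝔞 ∣ 𝔞₁) (hb : 𝔟 ∣ 𝔟₁)
    (h : 𝔞₁ ⊔ 𝔟₁ = ⊤) : 𝔞 ⊔ 𝔟 = ⊤ := by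
  rw [eq_top_iff, ← h]
  exact sup_le_sup (Ideal.le_of_dvd ha) (Ideal.le_of_dvd hb)

/-- **The vanishing analysis** ("terms with `𝔰_{i,j}` not coprime to `𝔲_i`, `𝔲_j`, `𝔰_{i,a}`,
`𝔰_{b,j}` make no contribution"): if both `A(𝔲,𝔰)` and `B(𝔲,𝔰)` are good then the whole family
`(𝔲ᵢ)ᵢ, (𝔰_p)_p` is pairwise comaximal. [cite: CastilloEtAl2015, §2.2] -/
theorem coprime_of_isGood_rowT_colT {𝔲 : Fin k → Ideal (𝓞 K)} {𝔰 : OffDiag k → Ideal (𝓞 K)}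
    (hA : IsGood 𝔴 (rowT 𝔲 𝔰)) (hBc : IsGood 𝔴 (colT 𝔲 𝔰)) :
    (∀ i j, i ≠ j → 𝔲 i ⊔ 𝔲 j = ⊤) ∧ (∀ i p, 𝔲 i ⊔ 𝔰 p = ⊤) ∧
      ∀ p q : OffDiag k, p ≠ q → 𝔰 p ⊔ 𝔰 q = ⊤ := by
  refine ⟨fun i j hij => ?_, fun i p => ?_, fun p q hpq => ?_⟩
  · exact sup_eq_top_of_dvd_of_dvd (dvd_rowT 𝔲 𝔰 i) (dvd_rowT 𝔲 𝔰 j) (hA.sup_eq_top_of_ne hij)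
  · by_cases h : i = p.1.1
    · have hne : i ≠ p.1.2 := h ▸ p.2
      exact sup_eq_top_of_dvd_of_dvd (dvd_colT 𝔲 𝔰 i) (dvd_colT' 𝔲 𝔰 p) (hBc.sup_eq_top_of_ne hne)
    · exact sup_eq_top_of_dvd_of_dvd (dvd_rowT 𝔲 𝔰 i) (dvd_rowT' 𝔲 𝔰 p) (hA.sup_eq_top_of_ne h)
  · by_cases h : p.1.1 = q.1.1
    · have hne : p.1.2 ≠ q.1.2 := by
        intro h2
        exact hpq (Subtype.ext (Prod.ext h h2))
      exact sup_eq_top_of_dvd_of_dvd (dvd_colT' 𝔲 𝔰 p) (dvd_colT' 𝔲 𝔰 q) (hBc.sup_eq_top_of_ne hne)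
    · exact sup_eq_top_of_dvd_of_dvd (dvd_rowT' 𝔲 𝔰 p) (dvd_rowT' 𝔲 𝔰 q) (hA.sup_eq_top_of_ne h)

omit [NumberField K] in
/-- A coprime-multiplicative function is multiplicative over pairwise comaximal finite products.
[folklore] -/
theorem map_prod_of_pairwise {ι : Type*} (hρ : ∀ 𝔞 𝔟 : Ideal (𝓞 K), 𝔞 ⊔ 𝔟 = ⊤ → ρ (𝔞 * 𝔟) = ρ 𝔞 * ρ 𝔟)
    (hρ1 : ρ ⊤ = 1) (t : Finset ι) (f : ι → Ideal (𝓞 K))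
    (h : ∀ x ∈ t, ∀ y ∈ t, x ≠ y → f x ⊔ f y = ⊤) : ρ (∏ x ∈ t, f x) = ∏ x ∈ t, ρ (f x) := by
  induction t using Finset.induction_on with
  | empty => simp [Ideal.one_eq_top, hρ1]
  | insert a t hat ih =>
    rw [Finset.prod_insert hat, Finset.prod_insert hat]
    have hcop : f a ⊔ ∏ x ∈ t, f x = ⊤ :=
      Ideal.sup_prod_eq_top fun x hx => h a (Finset.mem_insert_self _ _) x
        (Finset.mem_insert_of_mem hx) (fun hax => hat (hax ▸ hx))
    rw [hρ _ _ hcop, ih (fun x hx y hy hxy => h x (Finset.mem_insert_of_mem hx) y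
      (Finset.mem_insert_of_mem hy) hxy)]

omit [NumberField K] in
/-- Pairwise comaximal ideals: `inf = product`. [folklore] -/
theorem finsetInf_eq_prod {ι : Type*} (t : Finset ι) (f : ι → Ideal (𝓞 K))
    (h : ∀ x ∈ t, ∀ y ∈ t, x ≠ y → f x ⊔ f y = ⊤) : t.inf f = ∏ x ∈ t, f x := by
  rw [Finset.inf_eq_iInf, Ideal.prod_eq_iInf_of_pairwise_isCoprime]
  intro x hx y hy hxy
  exact Ideal.isCoprime_iff_sup_eq.2 (h x hx y hy hxy)

omit [NumberField K] in
/-- Under pairwise comaximality, `Aᵢ = 𝔲ᵢ ∏_{p.1 = i} 𝔰_p`. [folklore] -/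
theorem rowT_eq_mul_prod {𝔲 : Fin k → Ideal (𝓞 K)} {𝔰 : OffDiag k → Ideal (𝓞 K)}
    (h2 : ∀ i p, 𝔲 i ⊔ 𝔰 p = ⊤) (h3 : ∀ p q : OffDiag k, p ≠ q → 𝔰 p ⊔ 𝔰 q = ⊤) (i : Fin k) :
    rowT 𝔲 𝔰 i = 𝔲 i * ∏ p ∈ Finset.univ.filter (fun p : OffDiag k => p.1.1 = i), 𝔰 p := by
  rw [rowT, finsetInf_eq_prod _ _ (fun x _ y _ hxy => h3 x y hxy),
    ← Ideal.mul_eq_inf_of_coprime (Ideal.sup_prod_eq_top fun p _ => h2 i p)]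

omit [NumberField K] in
/-- Under pairwise comaximality, `Bⱼ = 𝔲ⱼ ∏_{p.2 = j} 𝔰_p`. [folklore] -/
theorem colT_eq_mul_prod {𝔲 : Fin k → Ideal (𝓞 K)} {𝔰 : OffDiag k → Ideal (𝓞 K)}
    (h2 : ∀ i p, 𝔲 i ⊔ 𝔰 p = ⊤) (h3 : ∀ p q : OffDiag k, p ≠ q → 𝔰 p ⊔ 𝔰 q = ⊤) (j : Fin k) :
    colT 𝔲 𝔰 j = 𝔲 j * ∏ p ∈ Finset.univ.filter (fun p : OffDiag k => p.1.2 = j), 𝔰 p := by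
  rw [colT, finsetInf_eq_prod _ _ (fun x _ y _ hxy => h3 x y hxy),
    ← Ideal.mul_eq_inf_of_coprime (Ideal.sup_prod_eq_top fun p _ => h2 j p)]

omit [NumberField K] in
/-- Under pairwise comaximality, `∏ᵢ ρ(Aᵢ) = ∏ᵢ ρ(𝔲ᵢ) · ∏_p ρ(𝔰_p)`. [folklore] -/
theorem prod_rho_rowT_eq (hρ : ∀ 𝔞 𝔟 : Ideal (𝓞 K), 𝔞 ⊔ 𝔟 = ⊤ → ρ (𝔞 * 𝔟) = ρ 𝔞 * ρ 𝔟)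
    (hρ1 : ρ ⊤ = 1) {𝔲 : Fin k → Ideal (𝓞 K)} {𝔰 : OffDiag k → Ideal (𝓞 K)}
    (h2 : ∀ i p, 𝔲 i ⊔ 𝔰 p = ⊤) (h3 : ∀ p q : OffDiag k, p ≠ q → 𝔰 p ⊔ 𝔰 q = ⊤) :
    ∏ i, ρ (rowT 𝔲 𝔰 i) = (∏ i, ρ (𝔲 i)) * ∏ p, ρ (𝔰 p) := by
  have : ∀ i, ρ (rowT 𝔲 𝔰 i) =
      ρ (𝔲 i) * ∏ p ∈ Finset.univ.filter (fun p : OffDiag k => p.1.1 = i), ρ (𝔰 p) := by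
    intro i
    rw [rowT_eq_mul_prod h2 h3 i, hρ _ _ (Ideal.sup_prod_eq_top fun p _ => h2 i p),
      map_prod_of_pairwise hρ hρ1 _ _ fun x _ y _ hxy => h3 x y hxy]
  simp_rw [this]
  rw [Finset.prod_mul_distrib, Finset.prod_fiberwise (s := Finset.univ)
    (g := fun p : OffDiag k => p.1.1) (f := fun p => ρ (𝔰 p))]

omit [NumberField K] in
/-- Under pairwise comaximality, `∏ⱼ ρ(Bⱼ) = ∏ⱼ ρ(𝔲ⱼ) · ∏_p ρ(𝔰_p)`. [folklore] -/
theorem prod_rho_colT_eq (hρ : ∀ 𝔞 𝔟 : Ideal (𝓞 K), 𝔞 ⊔ 𝔟 = ⊤ → ρ (𝔞 * 𝔟) = ρ 𝔞 * ρ 𝔟)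
    (hρ1 : ρ ⊤ = 1) {𝔲 : Fin k → Ideal (𝓞 K)} {𝔰 : OffDiag k → Ideal (𝓞 K)}
    (h2 : ∀ i p, 𝔲 i ⊔ 𝔰 p = ⊤) (h3 : ∀ p q : OffDiag k, p ≠ q → 𝔰 p ⊔ 𝔰 q = ⊤) :
    ∏ j, ρ (colT 𝔲 𝔰 j) = (∏ j, ρ (𝔲 j)) * ∏ p, ρ (𝔰 p) := by
  have : ∀ j, ρ (colT 𝔲 𝔰 j) =
      ρ (𝔲 j) * ∏ p ∈ Finset.univ.filter (fun p : OffDiag k => p.1.2 = j), ρ (𝔰 p) := by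
    intro j
    rw [colT_eq_mul_prod h2 h3 j, hρ _ _ (Ideal.sup_prod_eq_top fun p _ => h2 j p),
      map_prod_of_pairwise hρ hρ1 _ _ fun x _ y _ hxy => h3 x y hxy]
  simp_rw [this]
  rw [Finset.prod_mul_distrib, Finset.prod_fiberwise (s := Finset.univ)
    (g := fun p : OffDiag k => p.1.2) (f := fun p => ρ (𝔰 p))]

/-- If `S(A) ≠ 0` then `A` is a good tuple of the box. [folklore] -/
theorem mem_boxG_of_Ssum_ne_zero (cf : (Fin k → Ideal (𝓞 K)) → ℝ) {A : Fin k → Ideal (𝓞 K)}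
    (h : Ssum K 𝔴 B ψ cf A ≠ 0) : A ∈ boxG K k 𝔴 B := by
  obtain ⟨𝔡, hd, -⟩ := Finset.exists_ne_zero_of_sum_ne_zero h
  rw [Finset.mem_filter] at hd
  obtain ⟨hd, hA⟩ := hd
  have hdG := apply_mem_G1_of_mem_boxG hd
  rw [mem_boxG] at hd ⊢
  refine ⟨?_, hd.2.of_dvd hA⟩
  rw [mem_box_iff]
  intro i
  exact (mem_G1.1 (mem_G1_of_dvd (hdG i) (hA i))).1

/-- `|∏ μ(Aᵢ)| = 1` for a tuple of good scalars. [folklore] -/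
theorem abs_prod_moebius_eq_one {A : Fin k → Ideal (𝓞 K)} (hA : ∀ i, A i ∈ G1 K 𝔴 B) :
    |∏ i, (idealMoebius (A i) : ℝ)| = 1 := by
  rw [Finset.abs_prod]
  refine Finset.prod_eq_one fun i _ => ?_
  rw [idealMoebius_apply_of_squarefree (mem_G1.1 (hA i)).2.1]
  push_cast
  rw [abs_pow, abs_neg, abs_one, one_pow]

/-- `|S(A)| ≤ Y_max/∏ ρ(Aᵢ)` for good `A` (`|μ(Aᵢ)| = 1`, `ρ(Aᵢ) > 0`). [folklore] -/
theorem abs_Ssum_le (hρpos : ∀ 𝔫 ∈ G1 K 𝔴 B, 0 < ρ 𝔫) (cf : (Fin k → Ideal (𝓞 K)) → ℝ) {Ymax : ℝ}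
    (hY : ∀ A ∈ boxG K k 𝔴 B, |Yv K 𝔴 B ψ ρ cf A| ≤ Ymax) {A : Fin k → Ideal (𝓞 K)}
    (hA : A ∈ boxG K k 𝔴 B) : |Ssum K 𝔴 B ψ cf A| ≤ Ymax / ∏ i, ρ (A i) := by
  have hAG := apply_mem_G1_of_mem_boxG hA
  have hρA : 0 < ∏ i, ρ (A i) := Finset.prod_pos fun i _ => hρpos _ (hAG i)
  have hμ := abs_prod_moebius_eq_one hAG
  have key := hY A hA
  rw [Yv, Finset.prod_mul_distrib, abs_mul, abs_mul, hμ, one_mul, abs_of_pos hρA] at key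
  rw [le_div_iff₀ hρA, mul_comm]
  exact key

/-- **The bound for one off-diagonal term**: for good `𝔲` and any family `𝔰` of good scalars,
`|∏ρ(𝔲ᵢ) ∏μ(𝔰_p) S(A(𝔲,𝔰)) S(B(𝔲,𝔰))| ≤ Y_max²/(∏ρ(𝔲ᵢ) ∏ρ(𝔰_p)²)` (Maynard's (5.13) summand over
ideals). [cite: CastilloEtAl2015, §2.2] -/
theorem abs_offdiag_term_le (hρ : ∀ 𝔞 𝔟 : Ideal (𝓞 K), 𝔞 ⊔ 𝔟 = ⊤ → ρ (𝔞 * 𝔟) = ρ 𝔞 * ρ 𝔟)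
    (hρ1 : ρ ⊤ = 1) (hρpos : ∀ 𝔫 ∈ G1 K 𝔴 B, 0 < ρ 𝔫) (cf : (Fin k → Ideal (𝓞 K)) → ℝ) {Ymax : ℝ}
    (hY : ∀ A ∈ boxG K k 𝔴 B, |Yv K 𝔴 B ψ ρ cf A| ≤ Ymax)
    {𝔲 : Fin k → Ideal (𝓞 K)} (hu : 𝔲 ∈ boxG K k 𝔴 B) {𝔰 : OffDiag k → Ideal (𝓞 K)}
    (hs : 𝔰 ∈ sboxG K k 𝔴 B) :
    |(∏ i, ρ (𝔲 i)) * (∏ p, (idealMoebius (𝔰 p) : ℝ)) *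
        (Ssum K 𝔴 B ψ cf (rowT 𝔲 𝔰) * Ssum K 𝔴 B ψ cf (colT 𝔲 𝔰))| ≤
      Ymax ^ 2 / ((∏ i, ρ (𝔲 i)) * ∏ p, ρ (𝔰 p) ^ 2) := by
  have huG := apply_mem_G1_of_mem_boxG hu
  have hsG : ∀ p, 𝔰 p ∈ G1 K 𝔴 B := fun p => Fintype.mem_piFinset.1 hs p
  have hρu : 0 < ∏ i, ρ (𝔲 i) := Finset.prod_pos fun i _ => hρpos _ (huG i)
  have hρs : 0 < ∏ p, ρ (𝔰 p) := Finset.prod_pos fun p _ => hρpos _ (hsG p)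
  have hYmax : 0 ≤ Ymax := le_trans (abs_nonneg _) (hY 𝔲 hu)
  have hRHS : 0 ≤ Ymax ^ 2 / ((∏ i, ρ (𝔲 i)) * ∏ p, ρ (𝔰 p) ^ 2) := by positivity
  by_cases h0 : Ssum K 𝔴 B ψ cf (rowT 𝔲 𝔰) = 0 ∨ Ssum K 𝔴 B ψ cf (colT 𝔲 𝔰) = 0
  · rcases h0 with h0 | h0 <;> simp [h0, hRHS]
  push Not at h0
  have hA := mem_boxG_of_Ssum_ne_zero cf h0.1
  have hBc := mem_boxG_of_Ssum_ne_zero cf h0.2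
  obtain ⟨-, h2, h3⟩ := coprime_of_isGood_rowT_colT (mem_boxG.1 hA).2 (mem_boxG.1 hBc).2
  have eA := prod_rho_rowT_eq hρ hρ1 h2 h3
  have eB := prod_rho_colT_eq hρ hρ1 h2 h3
  have bA := abs_Ssum_le hρpos cf hY hA
  have bB := abs_Ssum_le hρpos cf hY hBc
  rw [eA] at bA
  rw [eB] at bB
  have hμ : |∏ p, (idealMoebius (𝔰 p) : ℝ)| ≤ 1 := by
    rw [Finset.abs_prod]
    refine Finset.prod_le_one (fun _ _ => abs_nonneg _) fun p _ => ?_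
    exact_mod_cast abs_idealMoebius_le_one (𝔰 p)
  have hprod : 0 < (∏ i, ρ (𝔲 i)) * ∏ p, ρ (𝔰 p) := mul_pos hρu hρs
  calc |(∏ i, ρ (𝔲 i)) * (∏ p, (idealMoebius (𝔰 p) : ℝ)) *
          (Ssum K 𝔴 B ψ cf (rowT 𝔲 𝔰) * Ssum K 𝔴 B ψ cf (colT 𝔲 𝔰))|
      = (∏ i, ρ (𝔲 i)) * |∏ p, (idealMoebius (𝔰 p) : ℝ)| *
          (|Ssum K 𝔴 B ψ cf (rowT 𝔲 𝔰)| * |Ssum K 𝔴 B ψ cf (colT 𝔲 𝔰)|) := by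
        rw [abs_mul, abs_mul, abs_mul, abs_of_pos hρu]
    _ ≤ (∏ i, ρ (𝔲 i)) * 1 *
          ((Ymax / ((∏ i, ρ (𝔲 i)) * ∏ p, ρ (𝔰 p))) * (Ymax / ((∏ i, ρ (𝔲 i)) * ∏ p, ρ (𝔰 p)))) := by
        refine mul_le_mul (mul_le_mul_of_nonneg_left hμ hρu.le)
          (mul_le_mul bA bB (abs_nonneg _) (le_trans (abs_nonneg _) bA))
          (mul_nonneg (abs_nonneg _) (abs_nonneg _)) (by rw [mul_one]; exact hρu.le)
    _ = Ymax ^ 2 / ((∏ i, ρ (𝔲 i)) * ∏ p, ρ (𝔰 p) ^ 2) := by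
        rw [Finset.prod_pow]
        have h1 : (∏ i, ρ (𝔲 i)) ≠ 0 := hρu.ne'
        have h2 : (∏ p, ρ (𝔰 p)) ≠ 0 := hρs.ne'
        field_simp

/-- `μ(𝔲)² = 1` in `ℝ` for good scalars (square-free). [folklore] -/
theorem prod_moebius_sq_eq_one {𝔲 : Fin k → Ideal (𝓞 K)} (hu : ∀ i, 𝔲 i ∈ G1 K 𝔴 B) :
    (∏ i, (idealMoebius (𝔲 i) : ℝ)) ^ 2 = 1 := by
  rw [← Finset.prod_pow]
  exact Finset.prod_eq_one fun i _ => idealMoebius_sq_of_squarefree (mem_G1.1 (hu i)).2.1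

/-- **The diagonal term**: for good `𝔲`, the `𝔰 = 1` summand is `Y_𝔲²/∏ρ(𝔲ᵢ)`.
[cite: CastilloEtAl2015, §2.2] -/
theorem diag_term_eq (hρpos : ∀ 𝔫 ∈ G1 K 𝔴 B, 0 < ρ 𝔫) (cf : (Fin k → Ideal (𝓞 K)) → ℝ)
    {𝔲 : Fin k → Ideal (𝓞 K)} (hu : 𝔲 ∈ boxG K k 𝔴 B) :
    (∏ i, ρ (𝔲 i)) * (∏ p, (idealMoebius (oneFam K k p) : ℝ)) *
        (Ssum K 𝔴 B ψ cf (rowT 𝔲 (oneFam K k)) * Ssum K 𝔴 B ψ cf (colT 𝔲 (oneFam K k))) =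
      Yv K 𝔴 B ψ ρ cf 𝔲 ^ 2 / ∏ i, ρ (𝔲 i) := by
  have huG := apply_mem_G1_of_mem_boxG hu
  have hρu : 0 < ∏ i, ρ (𝔲 i) := Finset.prod_pos fun i _ => hρpos _ (huG i)
  have hμ2 := prod_moebius_sq_eq_one huG
  rw [rowT_oneFam, colT_oneFam]
  simp only [oneFam, idealMoebius_top, Int.cast_one, Finset.prod_const_one, mul_one]
  rw [Yv, Finset.prod_mul_distrib, eq_div_iff hρu.ne']
  calc (∏ i, ρ (𝔲 i)) * (Ssum K 𝔴 B ψ cf 𝔲 * Ssum K 𝔴 B ψ cf 𝔲) * ∏ i, ρ (𝔲 i)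
      = (∏ i, (idealMoebius (𝔲 i) : ℝ)) ^ 2 * (∏ i, ρ (𝔲 i)) ^ 2 * Ssum K 𝔴 B ψ cf 𝔲 ^ 2 := by
        rw [hμ2]; ring
    _ = _ := by ring

/-- **The bilinear form: diagonal plus error** (Maynard (5.14) over ideals): with
`L_ρ = ∑_{𝔲 ∈ G1} 1/ρ(𝔲)`, `Z_ρ = ∑_{𝔰 ∈ G1} 1/ρ(𝔰)²` and `K = #OffDiag = k² − k`,
`|∑'_{𝔡,𝔢} Λ_𝔡Λ_𝔢/∏ψ([𝔡ᵢ,𝔢ᵢ]) − ∑_𝔲 Y_𝔲²/∏ρ(𝔲ᵢ)| ≤ Y_max² L_ρ^k (Z_ρ^K − 1)`.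
[cite: CastilloEtAl2015, §2.2] -/
theorem abs_bilinear_sub_diag_le (hψ : ∀ 𝔞 𝔟 : Ideal (𝓞 K), 𝔞 ⊔ 𝔟 = ⊤ → ψ (𝔞 * 𝔟) = ψ 𝔞 * ψ 𝔟)
    (hρ : ∀ 𝔞 𝔟 : Ideal (𝓞 K), 𝔞 ⊔ 𝔟 = ⊤ → ρ (𝔞 * 𝔟) = ρ 𝔞 * ρ 𝔟) (hρ1 : ρ ⊤ = 1)
    (hρψ : ∀ 𝔫 ∈ G1 K 𝔴 B, ∑ 𝔲 ∈ idealDivisors K 𝔫, ρ 𝔲 = ψ 𝔫)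
    (hψpos : ∀ 𝔫 ∈ G1 K 𝔴 B, 0 < ψ 𝔫) (hρpos : ∀ 𝔫 ∈ G1 K 𝔴 B, 0 < ρ 𝔫) (hB : 1 ≤ B)
    (cf : (Fin k → Ideal (𝓞 K)) → ℝ) {Ymax : ℝ} (hY : ∀ A ∈ boxG K k 𝔴 B, |Yv K 𝔴 B ψ ρ cf A| ≤ Ymax) :
    |∑ 𝔡 ∈ boxG K k 𝔴 B, ∑ 𝔢 ∈ boxG K k 𝔴 B,
        (if ∀ p : OffDiag k, 𝔡 p.1.1 ⊔ 𝔢 p.1.2 = ⊤ then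
          cf 𝔡 * cf 𝔢 / ∏ i, ψ (𝔡 i ⊓ 𝔢 i) else 0) -
        ∑ 𝔲 ∈ boxG K k 𝔴 B, Yv K 𝔴 B ψ ρ cf 𝔲 ^ 2 / ∏ i, ρ (𝔲 i)| ≤
      Ymax ^ 2 * (∑ 𝔫 ∈ G1 K 𝔴 B, 1 / ρ 𝔫) ^ k *
        ((∑ 𝔫 ∈ G1 K 𝔴 B, 1 / ρ 𝔫 ^ 2) ^ Fintype.card (OffDiag k) - 1) := by
  rw [bilinear_rearrange hψ hρψ hψpos cf]
  set F : (Fin k → Ideal (𝓞 K)) → (OffDiag k → Ideal (𝓞 K)) → ℝ := fun 𝔲 𝔰 =>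
    (∏ i, ρ (𝔲 i)) * (∏ p, (idealMoebius (𝔰 p) : ℝ)) *
      (Ssum K 𝔴 B ψ cf (rowT 𝔲 𝔰) * Ssum K 𝔴 B ψ cf (colT 𝔲 𝔰)) with hF
  have h1 : ∀ 𝔲 ∈ boxG K k 𝔴 B, ∑ 𝔰 ∈ sboxG K k 𝔴 B, F 𝔲 𝔰 =
      Yv K 𝔴 B ψ ρ cf 𝔲 ^ 2 / ∏ i, ρ (𝔲 i) + ∑ 𝔰 ∈ (sboxG K k 𝔴 B).erase (oneFam K k), F 𝔲 𝔰 := by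
    intro 𝔲 hu
    rw [← Finset.add_sum_erase _ _ (oneFam_mem_sboxG hB), hF]
    dsimp only
    rw [diag_term_eq hρpos cf hu]
  rw [Finset.sum_congr rfl h1, Finset.sum_add_distrib, add_sub_cancel_left]
  have hYmax2 : 0 ≤ Ymax ^ 2 := sq_nonneg _
  calc |∑ 𝔲 ∈ boxG K k 𝔴 B, ∑ 𝔰 ∈ (sboxG K k 𝔴 B).erase (oneFam K k), F 𝔲 𝔰|
      ≤ ∑ 𝔲 ∈ boxG K k 𝔴 B, ∑ 𝔰 ∈ (sboxG K k 𝔴 B).erase (oneFam K k), |F 𝔲 𝔰| := by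
        refine (Finset.abs_sum_le_sum_abs _ _).trans (Finset.sum_le_sum fun 𝔲 _ => ?_)
        exact Finset.abs_sum_le_sum_abs _ _
    _ ≤ ∑ 𝔲 ∈ boxG K k 𝔴 B, ∑ 𝔰 ∈ (sboxG K k 𝔴 B).erase (oneFam K k),
          Ymax ^ 2 * ((1 / ∏ i, ρ (𝔲 i)) * ∏ p, 1 / ρ (𝔰 p) ^ 2) := by
        refine Finset.sum_le_sum fun 𝔲 hu => Finset.sum_le_sum fun 𝔰 hs => ?_
        have hs' := Finset.mem_of_mem_erase hs
        refine (abs_offdiag_term_le hρ hρ1 hρpos cf hY hu hs').trans (le_of_eq ?_)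
        rw [Finset.prod_div_distrib, Finset.prod_const_one]
        field_simp
    _ = Ymax ^ 2 * ((∑ 𝔲 ∈ boxG K k 𝔴 B, 1 / ∏ i, ρ (𝔲 i)) *
          ∑ 𝔰 ∈ (sboxG K k 𝔴 B).erase (oneFam K k), ∏ p, 1 / ρ (𝔰 p) ^ 2) := by
        rw [Finset.sum_mul_sum, Finset.mul_sum]
        refine Finset.sum_congr rfl fun 𝔲 _ => ?_
        rw [Finset.mul_sum]
    _ ≤ Ymax ^ 2 * ((∑ 𝔫 ∈ G1 K 𝔴 B, 1 / ρ 𝔫) ^ k *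
          ((∑ 𝔫 ∈ G1 K 𝔴 B, 1 / ρ 𝔫 ^ 2) ^ Fintype.card (OffDiag k) - 1)) := by
        refine mul_le_mul_of_nonneg_left ?_ hYmax2
        have hZ0 : ∀ 𝔰 ∈ (sboxG K k 𝔴 B).erase (oneFam K k), 0 ≤ ∏ p, 1 / ρ (𝔰 p) ^ 2 :=
          fun 𝔰 _ => Finset.prod_nonneg fun p _ => div_nonneg zero_le_one (sq_nonneg _)
        have hG0 : 0 ≤ ∑ 𝔫 ∈ G1 K 𝔴 B, 1 / ρ 𝔫 :=
          Finset.sum_nonneg fun 𝔫 hn => div_nonneg zero_le_one (hρpos 𝔫 hn).le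
        refine mul_le_mul ?_ ?_ (Finset.sum_nonneg hZ0) (pow_nonneg hG0 k)
        · calc ∑ 𝔲 ∈ boxG K k 𝔴 B, 1 / ∏ i, ρ (𝔲 i)
              = ∑ 𝔲 ∈ boxG K k 𝔴 B, ∏ i, 1 / ρ (𝔲 i) := by
                refine Finset.sum_congr rfl fun 𝔲 _ => ?_
                rw [one_div, ← Finset.prod_inv_distrib]
                exact Finset.prod_congr rfl fun i _ => (one_div _).symm
            _ ≤ ∑ 𝔲 ∈ Fintype.piFinset (fun _ : Fin k => G1 K 𝔴 B), ∏ i, 1 / ρ (𝔲 i) := by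
                refine Finset.sum_le_sum_of_subset_of_nonneg (boxG_subset_piFinset k 𝔴 B) ?_
                intro 𝔲 hu _
                exact Finset.prod_nonneg fun i _ =>
                  div_nonneg zero_le_one (hρpos _ (Fintype.mem_piFinset.1 hu i)).le
            _ = (∑ 𝔫 ∈ G1 K 𝔴 B, 1 / ρ 𝔫) ^ k := by
                rw [← Finset.prod_univ_sum (fun _ : Fin k => G1 K 𝔴 B) (fun _ 𝔫 => 1 / ρ 𝔫),
                  Finset.prod_const, Finset.card_univ, Fintype.card_fin]
        · rw [Finset.sum_erase_eq_sub (oneFam_mem_sboxG hB)]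
          have hone : ∏ p : OffDiag k, 1 / ρ (oneFam K k p) ^ 2 = 1 := by
            simp [oneFam, hρ1]
          rw [hone, sboxG, ← Finset.prod_univ_sum (fun _ : OffDiag k => G1 K 𝔴 B)
            (fun _ 𝔫 => 1 / ρ 𝔫 ^ 2), Finset.prod_const, Finset.card_univ]
    _ = _ := by ring

/-- If the coefficients are supported on `𝔡` with `𝔡_m = (1)`, the off-diagonal term at `(𝔲, 𝔰)`
vanishes unless `𝔲_m = (1)`. [folklore] -/
theorem Ssum_rowT_eq_zero_of_ne (cf : (Fin k → Ideal (𝓞 K)) → ℝ) {m : Fin k}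
    (hm : ∀ 𝔡, cf 𝔡 ≠ 0 → 𝔡 m = ⊤) {𝔲 : Fin k → Ideal (𝓞 K)} (hum : 𝔲 m ≠ ⊤)
    (𝔰 : OffDiag k → Ideal (𝓞 K)) : Ssum K 𝔴 B ψ cf (rowT 𝔲 𝔰) = 0 := by
  refine Finset.sum_eq_zero fun 𝔡 hd => ?_
  rw [Finset.mem_filter] at hd
  have : cf 𝔡 = 0 := by
    by_contra h
    have hdm := hm 𝔡 h
    have : 𝔲 m ∣ ⊤ := hdm ▸ (dvd_rowT 𝔲 𝔰 m).trans (hd.2 m)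
    exact hum (Ideal.isUnit_iff.1 (isUnit_of_dvd_one (by rwa [Ideal.one_eq_top])))
  rw [this, zero_div]

/-- **The bilinear form: diagonal plus error, slot version** (for Lemma 5.2, coefficients supported on
`𝔡_m = (1)`): `|∑' − ∑_𝔲 Y_𝔲²/∏ρ(𝔲ᵢ)| ≤ Y_max² L_ρ^{k−1} (Z_ρ^K − 1)`. [cite: CastilloEtAl2015, §2.2] -/
theorem abs_bilinear_sub_diag_le_slot
    (hψ : ∀ 𝔞 𝔟 : Ideal (𝓞 K), 𝔞 ⊔ 𝔟 = ⊤ → ψ (𝔞 * 𝔟) = ψ 𝔞 * ψ 𝔟)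
    (hρ : ∀ 𝔞 𝔟 : Ideal (𝓞 K), 𝔞 ⊔ 𝔟 = ⊤ → ρ (𝔞 * 𝔟) = ρ 𝔞 * ρ 𝔟) (hρ1 : ρ ⊤ = 1)
    (hρψ : ∀ 𝔫 ∈ G1 K 𝔴 B, ∑ 𝔲 ∈ idealDivisors K 𝔫, ρ 𝔲 = ψ 𝔫)
    (hψpos : ∀ 𝔫 ∈ G1 K 𝔴 B, 0 < ψ 𝔫) (hρpos : ∀ 𝔫 ∈ G1 K 𝔴 B, 0 < ρ 𝔫) (hB : 1 ≤ B)
    (cf : (Fin k → Ideal (𝓞 K)) → ℝ) {m : Fin k} (hm : ∀ 𝔡, cf 𝔡 ≠ 0 → 𝔡 m = ⊤) {Ymax : ℝ}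
    (hY : ∀ A ∈ boxG K k 𝔴 B, |Yv K 𝔴 B ψ ρ cf A| ≤ Ymax) :
    |∑ 𝔡 ∈ boxG K k 𝔴 B, ∑ 𝔢 ∈ boxG K k 𝔴 B,
        (if ∀ p : OffDiag k, 𝔡 p.1.1 ⊔ 𝔢 p.1.2 = ⊤ then
          cf 𝔡 * cf 𝔢 / ∏ i, ψ (𝔡 i ⊓ 𝔢 i) else 0) -
        ∑ 𝔲 ∈ boxG K k 𝔴 B, Yv K 𝔴 B ψ ρ cf 𝔲 ^ 2 / ∏ i, ρ (𝔲 i)| ≤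
      Ymax ^ 2 * (∑ 𝔫 ∈ G1 K 𝔴 B, 1 / ρ 𝔫) ^ (k - 1) *
        ((∑ 𝔫 ∈ G1 K 𝔴 B, 1 / ρ 𝔫 ^ 2) ^ Fintype.card (OffDiag k) - 1) := by
  rw [bilinear_rearrange hψ hρψ hψpos cf]
  set F : (Fin k → Ideal (𝓞 K)) → (OffDiag k → Ideal (𝓞 K)) → ℝ := fun 𝔲 𝔰 =>
    (∏ i, ρ (𝔲 i)) * (∏ p, (idealMoebius (𝔰 p) : ℝ)) *
      (Ssum K 𝔴 B ψ cf (rowT 𝔲 𝔰) * Ssum K 𝔴 B ψ cf (colT 𝔲 𝔰)) with hF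
  have h1 : ∀ 𝔲 ∈ boxG K k 𝔴 B, ∑ 𝔰 ∈ sboxG K k 𝔴 B, F 𝔲 𝔰 =
      Yv K 𝔴 B ψ ρ cf 𝔲 ^ 2 / ∏ i, ρ (𝔲 i) + ∑ 𝔰 ∈ (sboxG K k 𝔴 B).erase (oneFam K k), F 𝔲 𝔰 := by
    intro 𝔲 hu
    rw [← Finset.add_sum_erase _ _ (oneFam_mem_sboxG hB), hF]
    dsimp only
    rw [diag_term_eq hρpos cf hu]
  rw [Finset.sum_congr rfl h1, Finset.sum_add_distrib, add_sub_cancel_left]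
  have hvan : ∀ 𝔲 ∈ boxG K k 𝔴 B, 𝔲 m ≠ ⊤ →
      ∑ 𝔰 ∈ (sboxG K k 𝔴 B).erase (oneFam K k), F 𝔲 𝔰 = 0 := by
    intro 𝔲 _ hum
    refine Finset.sum_eq_zero fun 𝔰 _ => ?_
    simp only [hF, Ssum_rowT_eq_zero_of_ne cf hm hum 𝔰, zero_mul, mul_zero]
  rw [← Finset.sum_filter_of_ne (p := fun 𝔲 => 𝔲 m = ⊤) (fun 𝔲 hu hne => by
    by_contra h; exact hne (hvan 𝔲 hu h))]
  have hYmax2 : 0 ≤ Ymax ^ 2 := sq_nonneg _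
  calc |∑ 𝔲 ∈ (boxG K k 𝔴 B).filter (fun 𝔲 => 𝔲 m = ⊤),
          ∑ 𝔰 ∈ (sboxG K k 𝔴 B).erase (oneFam K k), F 𝔲 𝔰|
      ≤ ∑ 𝔲 ∈ (boxG K k 𝔴 B).filter (fun 𝔲 => 𝔲 m = ⊤),
          ∑ 𝔰 ∈ (sboxG K k 𝔴 B).erase (oneFam K k), |F 𝔲 𝔰| := by
        refine (Finset.abs_sum_le_sum_abs _ _).trans (Finset.sum_le_sum fun 𝔲 _ => ?_)
        exact Finset.abs_sum_le_sum_abs _ _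
    _ ≤ ∑ 𝔲 ∈ (boxG K k 𝔴 B).filter (fun 𝔲 => 𝔲 m = ⊤),
          ∑ 𝔰 ∈ (sboxG K k 𝔴 B).erase (oneFam K k),
            Ymax ^ 2 * ((1 / ∏ i, ρ (𝔲 i)) * ∏ p, 1 / ρ (𝔰 p) ^ 2) := by
        refine Finset.sum_le_sum fun 𝔲 hu => Finset.sum_le_sum fun 𝔰 hs => ?_
        have hs' := Finset.mem_of_mem_erase hs
        have hu' := (Finset.mem_filter.1 hu).1
        refine (abs_offdiag_term_le hρ hρ1 hρpos cf hY hu' hs').trans (le_of_eq ?_)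
        rw [Finset.prod_div_distrib, Finset.prod_const_one]
        field_simp
    _ = Ymax ^ 2 * ((∑ 𝔲 ∈ (boxG K k 𝔴 B).filter (fun 𝔲 => 𝔲 m = ⊤), 1 / ∏ i, ρ (𝔲 i)) *
          ∑ 𝔰 ∈ (sboxG K k 𝔴 B).erase (oneFam K k), ∏ p, 1 / ρ (𝔰 p) ^ 2) := by
        rw [Finset.sum_mul_sum, Finset.mul_sum]
        refine Finset.sum_congr rfl fun 𝔲 _ => ?_
        rw [Finset.mul_sum]
    _ ≤ Ymax ^ 2 * ((∑ 𝔫 ∈ G1 K 𝔴 B, 1 / ρ 𝔫) ^ (k - 1) *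
          ((∑ 𝔫 ∈ G1 K 𝔴 B, 1 / ρ 𝔫 ^ 2) ^ Fintype.card (OffDiag k) - 1)) := by
        refine mul_le_mul_of_nonneg_left ?_ hYmax2
        have hZ0 : ∀ 𝔰 ∈ (sboxG K k 𝔴 B).erase (oneFam K k), 0 ≤ ∏ p, 1 / ρ (𝔰 p) ^ 2 :=
          fun 𝔰 _ => Finset.prod_nonneg fun p _ => div_nonneg zero_le_one (sq_nonneg _)
        have hG0 : 0 ≤ ∑ 𝔫 ∈ G1 K 𝔴 B, 1 / ρ 𝔫 :=
          Finset.sum_nonneg fun 𝔫 hn => div_nonneg zero_le_one (hρpos 𝔫 hn).le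
        refine mul_le_mul ?_ ?_ (Finset.sum_nonneg hZ0) (pow_nonneg hG0 _)
        · calc ∑ 𝔲 ∈ (boxG K k 𝔴 B).filter (fun 𝔲 => 𝔲 m = ⊤), 1 / ∏ i, ρ (𝔲 i)
              = ∑ 𝔲 ∈ (boxG K k 𝔴 B).filter (fun 𝔲 => 𝔲 m = ⊤), ∏ i, 1 / ρ (𝔲 i) := by
                refine Finset.sum_congr rfl fun 𝔲 _ => ?_
                rw [one_div, ← Finset.prod_inv_distrib]
                exact Finset.prod_congr rfl fun i _ => (one_div _).symm
            _ ≤ ∑ 𝔲 ∈ Fintype.piFinset (fun i : Fin k =>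
                    if i = m then ({⊤} : Finset (Ideal (𝓞 K))) else G1 K 𝔴 B),
                  ∏ i, 1 / ρ (𝔲 i) := by
                refine Finset.sum_le_sum_of_subset_of_nonneg (fun 𝔲 hu => ?_) ?_
                · rw [Finset.mem_filter] at hu
                  rw [Fintype.mem_piFinset]
                  intro i
                  by_cases hi : i = m
                  · subst hi; rw [if_pos rfl, Finset.mem_singleton]; exact hu.2
                  · rw [if_neg hi]; exact apply_mem_G1_of_mem_boxG hu.1 i
                · intro 𝔲 hu _
                  rw [Fintype.mem_piFinset] at hu
                  refine Finset.prod_nonneg fun i _ => div_nonneg zero_le_one ?_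
                  have := hu i
                  by_cases hi : i = m
                  · subst hi
                    rw [if_pos rfl, Finset.mem_singleton] at this
                    rw [this, hρ1]; exact zero_le_one
                  · rw [if_neg hi] at this; exact (hρpos _ this).le
            _ = ∏ i : Fin k, ∑ 𝔫 ∈ (if i = m then ({⊤} : Finset (Ideal (𝓞 K))) else G1 K 𝔴 B),
                  1 / ρ 𝔫 := by
                rw [Finset.prod_univ_sum]
            _ = (∑ 𝔫 ∈ G1 K 𝔴 B, 1 / ρ 𝔫) ^ (k - 1) := by
                rw [← Finset.mul_prod_erase _ _ (Finset.mem_univ m), if_pos rfl, Finset.sum_singleton,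
                  hρ1, div_one, one_mul]
                rw [Finset.prod_congr rfl fun i hi => by rw [if_neg (Finset.mem_erase.1 hi).1],
                  Finset.prod_const, Finset.card_erase_of_mem (Finset.mem_univ m), Finset.card_univ,
                  Fintype.card_fin]
        · rw [Finset.sum_erase_eq_sub (oneFam_mem_sboxG hB)]
          have hone : ∏ p : OffDiag k, 1 / ρ (oneFam K k p) ^ 2 = 1 := by
            simp [oneFam, hρ1]
          rw [hone, sboxG, ← Finset.prod_univ_sum (fun _ : OffDiag k => G1 K 𝔴 B)
            (fun _ 𝔫 => 1 / ρ 𝔫 ^ 2), Finset.prod_const, Finset.card_univ]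
    _ = _ := by ring

end Bilinear2

end Literature.NumberTheory.Sieve.MaynardNF

namespace Literature.NumberTheory.Sieve.MaynardNF

open UniqueFactorizationMonoid Literature.NumberTheory.LFunctions
  Literature.NumberTheory.LFunctions.NumberField

variable {K : Type*} [Field K] [NumberField K]
variable {k : ℕ}

/-! ### The two instances over `𝓞_K`: `(ψ, ρ) = (N, φ)` for `S₁`, `(ψ, ρ) = (φ, g)` for `S₂^{(m)}` -/

section Instances

variable (K) in
/-- The absolute norm as a real-valued function on ideals. [folklore] -/
def normR (𝔫 : Ideal (𝓞 K)) : ℝ := (Ideal.absNorm 𝔫 : ℝ)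

variable (K) in
/-- Maynard's `g` over ideals: `g(𝔲) = ∏_{P ∣ 𝔲} (NP − 2)` (only ever evaluated at square-free `𝔲`).
[cite: CastilloEtAl2015, §2.2] -/
def gId (𝔲 : Ideal (𝓞 K)) : ℝ := ∏ P ∈ (normalizedFactors 𝔲).toFinset, ((Ideal.absNorm P : ℝ) - 2)

/-- `N` is multiplicative. [folklore] -/
theorem normR_mul (𝔞 𝔟 : Ideal (𝓞 K)) : normR K (𝔞 * 𝔟) = normR K 𝔞 * normR K 𝔟 := by
  simp [normR, map_mul]

/-- `N(1) = 1`. [folklore] -/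
theorem normR_top : normR K ⊤ = 1 := by simp [normR, Ideal.absNorm_top]

/-- The prime supports of comaximal nonzero ideals are disjoint and that of the product is their
union. [folklore] -/
theorem toFinset_normalizedFactors_mul {𝔞 𝔟 : Ideal (𝓞 K)} (ha : 𝔞 ≠ ⊥) (hb : 𝔟 ≠ ⊥)
    (h : 𝔞 ⊔ 𝔟 = ⊤) :
    (normalizedFactors (𝔞 * 𝔟)).toFinset = (normalizedFactors 𝔞).toFinset ∪ (normalizedFactors 𝔟).toFinset ∧
      Disjoint (normalizedFactors 𝔞).toFinset (normalizedFactors 𝔟).toFinset := by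
  have ha0 : (𝔞 : Ideal (𝓞 K)) ≠ 0 := by rwa [Ne, Ideal.zero_eq_bot]
  have hb0 : (𝔟 : Ideal (𝓞 K)) ≠ 0 := by rwa [Ne, Ideal.zero_eq_bot]
  refine ⟨by rw [normalizedFactors_mul ha0 hb0, Multiset.toFinset_add], ?_⟩
  rw [Finset.disjoint_left]
  intro P hPa hPb
  rw [Multiset.mem_toFinset] at hPa hPb
  have hno := (Literature.NumberTheory.Sieve.IdealSieve.sup_eq_top_iff_forall_not_dvd ha).1 h P hPa
  exact hno (dvd_of_mem_normalizedFactors hPb)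

/-- `φ` is multiplicative on comaximal ideals. [folklore] -/
theorem idealTotient_mul_of_coprime (𝔞 𝔟 : Ideal (𝓞 K)) (h : 𝔞 ⊔ 𝔟 = ⊤) :
    idealTotient K (𝔞 * 𝔟) = idealTotient K 𝔞 * idealTotient K 𝔟 := by
  by_cases ha : 𝔞 = ⊥
  · subst ha; simp [idealTotient]
  by_cases hb : 𝔟 = ⊥
  · subst hb; simp [idealTotient]
  obtain ⟨hunion, hdisj⟩ := toFinset_normalizedFactors_mul ha hb h
  rw [idealTotient, idealTotient, idealTotient, hunion, Finset.prod_union hdisj, map_mul, Nat.cast_mul]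
  ring

/-- `g` is multiplicative on comaximal ideals. [folklore] -/
theorem gId_mul_of_coprime (𝔞 𝔟 : Ideal (𝓞 K)) (h : 𝔞 ⊔ 𝔟 = ⊤) :
    gId K (𝔞 * 𝔟) = gId K 𝔞 * gId K 𝔟 := by
  by_cases ha : 𝔞 = ⊥
  · subst ha
    have hb : 𝔟 = ⊤ := by simpa using h
    subst hb
    simp [gId, ← Ideal.one_eq_top, normalizedFactors_one]
  by_cases hb : 𝔟 = ⊥
  · subst hb
    have ha' : 𝔞 = ⊤ := by simpa using h
    subst ha'
    simp [gId, ← Ideal.one_eq_top, normalizedFactors_one]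
  obtain ⟨hunion, hdisj⟩ := toFinset_normalizedFactors_mul ha hb h
  rw [gId, gId, gId, hunion, Finset.prod_union hdisj]

/-- `φ(1) = 1`. [folklore] -/
theorem idealTotient_top : idealTotient K ⊤ = 1 := by
  simp [idealTotient, ← Ideal.one_eq_top, normalizedFactors_one]

/-- `g(1) = 1`. [folklore] -/
theorem gId_top : gId K ⊤ = 1 := by
  simp [gId, ← Ideal.one_eq_top, normalizedFactors_one]

/-- `∑_{𝔲 ∣ 𝔫} φ(𝔲) = N𝔫` on `G1`. [folklore] -/
theorem sum_idealDivisors_idealTotient {𝔴 : Ideal (𝓞 K)} {B : ℝ} {𝔫 : Ideal (𝓞 K)}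
    (hn : 𝔫 ∈ G1 K 𝔴 B) : ∑ 𝔲 ∈ idealDivisors K 𝔫, idealTotient K 𝔲 = normR K 𝔫 :=
  sum_divisors_idealTotient (mem_G1.1 hn).1.1 fun _ => mem_idealDivisors (mem_G1.1 hn).1.1

/-- `∑_{𝔲 ∣ 𝔫} g(𝔲) = φ(𝔫)` for square-free nonzero `𝔫` (`∏_{P∣𝔫}(1 + (NP − 2)) = ∏_{P∣𝔫}(NP − 1)`).
[cite: CastilloEtAl2015, §2.2] -/
theorem sum_idealDivisors_gId {𝔫 : Ideal (𝓞 K)} (hn0 : 𝔫 ≠ ⊥) (hsq : Squarefree 𝔫) :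
    ∑ 𝔲 ∈ idealDivisors K 𝔫, gId K 𝔲 = idealTotient K 𝔫 := by
  have h := sum_divisors_ppMul (fun P _ => (Ideal.absNorm P : ℝ) - 2) hn0
    (fun _ => mem_idealDivisors hn0)
  change ∑ 𝔲 ∈ idealDivisors K 𝔫, ppMul (fun P _ => (Ideal.absNorm P : ℝ) - 2) 𝔲 = _ at h
  rw [show (fun 𝔲 => gId K 𝔲) = fun 𝔲 => ppMul (fun P _ => (Ideal.absNorm P : ℝ) - 2) 𝔲 from rfl]
    at *
  rw [h, idealTotient_of_squarefree hsq]
  have hnd := (squarefree_iff_nodup_normalizedFactors (by rwa [Ne, Ideal.zero_eq_bot])).1 hsq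
  refine Finset.prod_congr rfl fun P hP => ?_
  have h1 : Multiset.count P (normalizedFactors 𝔫) = 1 := by
    have := Multiset.nodup_iff_count_le_one.1 hnd P
    have := Multiset.one_le_count_iff_mem.2 (Multiset.mem_toFinset.1 hP)
    omega
  rw [h1]
  simp [Finset.sum_range_succ]
  ring

/-- `N > 0` on `G1`. [folklore] -/
theorem normR_pos_of_mem_G1 {𝔴 : Ideal (𝓞 K)} {B : ℝ} {𝔫 : Ideal (𝓞 K)} (hn : 𝔫 ∈ G1 K 𝔴 B) :
    0 < normR K 𝔫 := by
  rw [normR]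
  exact_mod_cast Nat.pos_of_ne_zero (by rw [Ne, Ideal.absNorm_eq_zero_iff]; exact (mem_G1.1 hn).1.1)

/-- `φ > 0` on `G1`. [folklore] -/
theorem idealTotient_pos_of_mem_G1 {𝔴 : Ideal (𝓞 K)} {B : ℝ} {𝔫 : Ideal (𝓞 K)}
    (hn : 𝔫 ∈ G1 K 𝔴 B) : 0 < idealTotient K 𝔫 :=
  idealTotient_pos (mem_G1.1 hn).1.1

/-- `g > 0` on `G1` when every prime of norm `2` divides `𝔴` (the analogue of `2 ∣ W`). [folklore] -/
theorem gId_pos_of_mem_G1 {𝔴 : Ideal (𝓞 K)} {B : ℝ}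
    (h2 : ∀ P : Ideal (𝓞 K), Prime P → Ideal.absNorm P = 2 → P ∣ 𝔴) {𝔫 : Ideal (𝓞 K)}
    (hn : 𝔫 ∈ G1 K 𝔴 B) : 0 < gId K 𝔫 := by
  obtain ⟨⟨hn0, -⟩, -, hcop⟩ := mem_G1.1 hn
  have hno := (Literature.NumberTheory.Sieve.IdealSieve.sup_eq_top_iff_forall_not_dvd hn0).1 hcop
  refine Finset.prod_pos fun P hP => ?_
  have hP' := Multiset.mem_toFinset.1 hP
  have hPp := prime_of_normalized_factor P hP'
  have hN2 : 2 ≤ Ideal.absNorm P := two_le_absNorm_of_prime hPp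
  have hne : Ideal.absNorm P ≠ 2 := fun h => hno P hP' (h2 P hPp h)
  have h3 : (3 : ℝ) ≤ Ideal.absNorm P := by
    have : 3 ≤ Ideal.absNorm P := by omega
    exact_mod_cast this
  linarith

/-- `Y = y`: for `Λ = λ(y)` and `(ψ, ρ) = (N, φ)` the diagonal variable is `y` itself (Maynard's
change of variables (5.8) is inverted by (5.10), over ideals). [cite: CastilloEtAl2015, §2.2] -/
theorem Yv_lam_eq {𝔴 : Ideal (𝓞 K)} {B : ℝ} {y : (Fin k → Ideal (𝓞 K)) → ℝ}
    (hy : SupportedOn K k 𝔴 B y) (A : Fin k → Ideal (𝓞 K)) :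
    Yv K 𝔴 B (normR K) (idealTotient K) (lam K k B y) A = y A := by
  rw [Yv, Ssum]
  have hzero : ∀ 𝔡 ∈ box K k B, ¬IsGood 𝔴 𝔡 → lam K k B y 𝔡 = 0 := by
    intro 𝔡 _ hng
    rw [lam_def]
    refine mul_eq_zero_of_right _ (Finset.sum_eq_zero fun 𝔯 hr => ?_)
    rw [Finset.mem_filter] at hr
    have : y 𝔯 = 0 := by
      by_contra h
      exact hng ((hy 𝔯 h).2.of_dvd hr.2)
    rw [this, zero_div]
  have hsum : ∑ 𝔡 ∈ (boxG K k 𝔴 B).filter (fun 𝔡 => ∀ i, A i ∣ 𝔡 i),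
      lam K k B y 𝔡 / ∏ i, normR K (𝔡 i) =
      ∑ 𝔡 ∈ (box K k B).filter (fun 𝔡 => ∀ i, A i ∣ 𝔡 i),
        lam K k B y 𝔡 / ∏ i, (Ideal.absNorm (𝔡 i) : ℝ) := by
    simp only [normR]
    refine Finset.sum_subset (fun 𝔡 hd => ?_) (fun 𝔡 hd hnd => ?_)
    · rw [Finset.mem_filter, mem_boxG] at hd
      exact Finset.mem_filter.2 ⟨hd.1.1, hd.2⟩
    · rw [Finset.mem_filter] at hd
      have hng : ¬IsGood 𝔴 𝔡 := fun hg => hnd (Finset.mem_filter.2 ⟨mem_boxG.2 ⟨hd.1, hg⟩, hd.2⟩)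
      rw [hzero 𝔡 hd.1 hng, zero_div]
  rw [hsum, sum_lam_div_prod_eq hy A]
  by_cases hyA : y A = 0
  · rw [hyA]; simp
  have hgood := (hy A hyA).2
  have hφ : (∏ i, idealTotient K (A i)) ≠ 0 :=
    Finset.prod_ne_zero_iff.2 fun i _ => (idealTotient_pos (hgood.ne_bot i)).ne'
  have hμ2 : ∀ i, (idealMoebius (A i) : ℝ) * (idealMoebius (A i) : ℝ) = 1 := fun i => by
    rw [← sq]; exact idealMoebius_sq_of_squarefree (hgood.squarefree_apply i)
  rw [Finset.prod_mul_distrib]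
  rw [show (∏ i, (idealMoebius (A i) : ℝ)) * (∏ i, idealTotient K (A i)) *
      ((∏ i, (idealMoebius (A i) : ℝ)) * y A / ∏ i, idealTotient K (A i)) =
      (∏ i, (idealMoebius (A i) : ℝ) * (idealMoebius (A i) : ℝ)) * y A by
    rw [Finset.prod_mul_distrib]; field_simp]
  simp [hμ2]

/-- **The main term of `S₁` over `𝓞_K`** (Maynard Lemma 5.1, (5.6)–(5.14), with ideals): for `y`
supported on good tuples of the box with `|y| ≤ y_max`,
`|∑'_{𝔡,𝔢} λ_𝔡λ_𝔢/∏N[𝔡ᵢ,𝔢ᵢ] − ∑_𝔲 y_𝔲²/∏φ(𝔲ᵢ)| ≤ y_max² L^k (Z^K − 1)`,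
`L = ∑_{𝔲 ∈ G1} 1/φ(𝔲)`, `Z = ∑_{𝔰 ∈ G1} 1/φ(𝔰)²`, `K = k² − k`. [cite: CastilloEtAl2015, §2.2] -/
theorem abs_S1main_sub_le {𝔴 : Ideal (𝓞 K)} {B : ℝ} (hB : 1 ≤ B) {y : (Fin k → Ideal (𝓞 K)) → ℝ}
    (hy : SupportedOn K k 𝔴 B y) {ymax : ℝ} (hymax : ∀ 𝔯, |y 𝔯| ≤ ymax) :
    |∑ 𝔡 ∈ boxG K k 𝔴 B, ∑ 𝔢 ∈ boxG K k 𝔴 B,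
        (if ∀ p : OffDiag k, 𝔡 p.1.1 ⊔ 𝔢 p.1.2 = ⊤ then
          lam K k B y 𝔡 * lam K k B y 𝔢 / ∏ i, (Ideal.absNorm (𝔡 i ⊓ 𝔢 i) : ℝ) else 0) -
        ∑ 𝔲 ∈ boxG K k 𝔴 B, y 𝔲 ^ 2 / ∏ i, idealTotient K (𝔲 i)| ≤
      ymax ^ 2 * (∑ 𝔫 ∈ G1 K 𝔴 B, 1 / idealTotient K 𝔫) ^ k *
        ((∑ 𝔫 ∈ G1 K 𝔴 B, 1 / idealTotient K 𝔫 ^ 2) ^ Fintype.card (OffDiag k) - 1) := by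
  have h := abs_bilinear_sub_diag_le (k := k) (𝔴 := 𝔴) (B := B) (ψ := normR K) (ρ := idealTotient K)
    (fun 𝔞 𝔟 _ => normR_mul 𝔞 𝔟) (fun 𝔞 𝔟 h => idealTotient_mul_of_coprime 𝔞 𝔟 h) idealTotient_top
    (fun 𝔫 hn => sum_idealDivisors_idealTotient hn)
    (fun _ hn => normR_pos_of_mem_G1 hn) (fun _ hn => idealTotient_pos_of_mem_G1 hn) hB (lam K k B y)
    (Ymax := ymax) (fun A _ => by rw [Yv_lam_eq hy]; exact hymax A)
  simp only [Yv_lam_eq hy, normR] at h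
  exact h

variable (K) in
/-- The coefficients of `S₂^{(m)}`: `λ_𝔡 [𝔡_m = (1)]`. [cite: CastilloEtAl2015, §2.2] -/
def lamM (k : ℕ) (B : ℝ) (y : (Fin k → Ideal (𝓞 K)) → ℝ) (m : Fin k) (𝔡 : Fin k → Ideal (𝓞 K)) : ℝ :=
  if 𝔡 m = ⊤ then lam K k B y 𝔡 else 0

/-- Unfolding `lamM`. [folklore] -/
theorem lamM_def (B : ℝ) (y : (Fin k → Ideal (𝓞 K)) → ℝ) (m : Fin k) (𝔡 : Fin k → Ideal (𝓞 K)) :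
    lamM K k B y m 𝔡 = if 𝔡 m = ⊤ then lam K k B y 𝔡 else 0 := rfl

variable (K) in
/-- **Maynard's `y^{(m)}` over `𝓞_K`** (`y^{(m)}_𝔯 = (∏ μ(𝔯ᵢ)g(𝔯ᵢ)) ∑_{𝔯ᵢ∣𝔡ᵢ, 𝔡_m=1} λ_𝔡/∏φ(𝔡ᵢ)`),
the diagonal variable of the pair `(φ, g)` for the coefficients `λ_𝔡 [𝔡_m = (1)]`.
[cite: CastilloEtAl2015, §2.2] -/
def ym (k : ℕ) (𝔴 : Ideal (𝓞 K)) (B : ℝ) (y : (Fin k → Ideal (𝓞 K)) → ℝ) (m : Fin k)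
    (𝔲 : Fin k → Ideal (𝓞 K)) : ℝ :=
  Yv K 𝔴 B (idealTotient K) (gId K) (lamM K k B y m) 𝔲

/-- **The main term of `S₂^{(m)}` over `𝓞_K`** (Maynard Lemma 5.2, (5.22)–(5.26)): if every prime of
norm `2` divides `𝔴` and `|y^{(m)}| ≤ y^{(m)}_max` on good tuples,
`|∑'_{𝔡,𝔢: 𝔡_m=𝔢_m=1} λ_𝔡λ_𝔢/∏φ([𝔡ᵢ,𝔢ᵢ]) − ∑_𝔲 (y^{(m)}_𝔲)²/∏g(𝔲ᵢ)| ≤ (y^{(m)}_max)² L_g^{k−1} (Z_g^K − 1)`.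
[cite: CastilloEtAl2015, §2.2] -/
theorem abs_S2main_sub_le {𝔴 : Ideal (𝓞 K)} {B : ℝ}
    (h2 : ∀ P : Ideal (𝓞 K), Prime P → Ideal.absNorm P = 2 → P ∣ 𝔴) (hB : 1 ≤ B)
    (y : (Fin k → Ideal (𝓞 K)) → ℝ) (m : Fin k) {ymmax : ℝ}
    (hym : ∀ 𝔲 ∈ boxG K k 𝔴 B, |ym K k 𝔴 B y m 𝔲| ≤ ymmax) :
    |∑ 𝔡 ∈ boxG K k 𝔴 B, ∑ 𝔢 ∈ boxG K k 𝔴 B,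
        (if ∀ p : OffDiag k, 𝔡 p.1.1 ⊔ 𝔢 p.1.2 = ⊤ then
          lamM K k B y m 𝔡 * lamM K k B y m 𝔢 / ∏ i, idealTotient K (𝔡 i ⊓ 𝔢 i) else 0) -
        ∑ 𝔲 ∈ boxG K k 𝔴 B, ym K k 𝔴 B y m 𝔲 ^ 2 / ∏ i, gId K (𝔲 i)| ≤
      ymmax ^ 2 * (∑ 𝔫 ∈ G1 K 𝔴 B, 1 / gId K 𝔫) ^ (k - 1) *
        ((∑ 𝔫 ∈ G1 K 𝔴 B, 1 / gId K 𝔫 ^ 2) ^ Fintype.card (OffDiag k) - 1) :=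
  abs_bilinear_sub_diag_le_slot (k := k) (𝔴 := 𝔴) (B := B) (ψ := idealTotient K) (ρ := gId K)
    (fun 𝔞 𝔟 h => idealTotient_mul_of_coprime 𝔞 𝔟 h) (fun 𝔞 𝔟 h => gId_mul_of_coprime 𝔞 𝔟 h)
    gId_top (fun _ hn => sum_idealDivisors_gId (mem_G1.1 hn).1.1 (mem_G1.1 hn).2.1)
    (fun _ hn => idealTotient_pos_of_mem_G1 hn) (fun _ hn => gId_pos_of_mem_G1 h2 hn) hB
    (lamM K k B y m) (fun 𝔡 hd => by
      by_contra h
      exact hd (by rw [lamM_def, if_neg h])) hym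

end Instances

end Literature.NumberTheory.Sieve.MaynardNF

namespace Literature.NumberTheory.Sieve.MaynardNF

open UniqueFactorizationMonoid Literature.NumberTheory.LFunctions
  Literature.NumberTheory.LFunctions.NumberField

variable {K : Type*} [Field K] [NumberField K]
variable {k : ℕ}

/-! ### Size of the weights: `λ_max ≤ y_max L^{2k}` -/

section LamBound

variable {𝔴 : Ideal (𝓞 K)} {B : ℝ}

/-- `λ_𝔡 = 0` unless `𝔡` is a good tuple of the box. [folklore] -/
theorem lam_eq_zero_of_not {y : (Fin k → Ideal (𝓞 K)) → ℝ} (hy : SupportedOn K k 𝔴 B y)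
    {𝔡 : Fin k → Ideal (𝓞 K)} (hd : 𝔡 ∉ boxG K k 𝔴 B) : lam K k B y 𝔡 = 0 := by
  rw [lam_def]
  by_cases hbox : 𝔡 ∈ box K k B
  · have hng : ¬IsGood 𝔴 𝔡 := fun hg => hd (mem_boxG.2 ⟨hbox, hg⟩)
    refine mul_eq_zero_of_right _ (Finset.sum_eq_zero fun 𝔯 hr => ?_)
    rw [Finset.mem_filter] at hr
    have : y 𝔯 = 0 := by
      by_contra h
      exact hng ((hy 𝔯 h).2.of_dvd hr.2)
    rw [this, zero_div]
  · -- some `𝔡 i` is `⊥` (then `μ(0)·N(0) = 0`) or has norm `> B` (empty sum)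
    rw [mem_box_iff] at hbox
    push Not at hbox
    obtain ⟨i, hi⟩ := hbox
    by_cases h0 : 𝔡 i = ⊥
    · refine mul_eq_zero_of_left ?_ _
      exact Finset.prod_eq_zero (Finset.mem_univ i) (by rw [h0]; simp)
    · refine mul_eq_zero_of_right _ (Finset.sum_eq_zero fun 𝔯 hr => ?_)
      exfalso
      rw [Finset.mem_filter, mem_box_iff] at hr
      have hlt : B < Ideal.absNorm (𝔡 i) := hi h0
      have hN : Ideal.absNorm (𝔯 i) ≠ 0 := by rw [Ne, Ideal.absNorm_eq_zero_iff]; exact (hr.1 i).1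
      have hle : (Ideal.absNorm (𝔡 i) : ℝ) ≤ Ideal.absNorm (𝔯 i) := by
        exact_mod_cast Nat.le_of_dvd (Nat.pos_of_ne_zero hN) (map_dvd _ (hr.2 i))
      linarith [(hr.1 i).2]

/-- For square-free nonzero `𝔡`: `∑_{𝔢 ∣ 𝔡} 1/φ(𝔢) = N𝔡/φ(𝔡)` (`∏_{P∣𝔡}(1 + 1/(NP−1)) = ∏ NP/(NP−1)`).
[cite: CastilloEtAl2015, §2.2] -/
theorem sum_divisors_inv_totient {𝔡 : Ideal (𝓞 K)} (hd0 : 𝔡 ≠ ⊥) (hd : Squarefree 𝔡) :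
    ∑ 𝔢 ∈ idealDivisors K 𝔡, 1 / idealTotient K 𝔢 = (Ideal.absNorm 𝔡 : ℝ) / idealTotient K 𝔡 := by
  -- `1/φ = ppMul (P ↦ 1/(NP − 1))` on square-free ideals; apply `sum_divisors_ppMul`
  have hnd := (squarefree_iff_nodup_normalizedFactors (by rwa [Ne, Ideal.zero_eq_bot] : (𝔡 : Ideal (𝓞 K)) ≠ 0)).1 hd
  have hcount1 : ∀ P ∈ (normalizedFactors 𝔡).toFinset, Multiset.count P (normalizedFactors 𝔡) = 1 := by
    intro P hP
    have := Multiset.nodup_iff_count_le_one.1 hnd P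
    have := Multiset.one_le_count_iff_mem.2 (Multiset.mem_toFinset.1 hP)
    omega
  have hφinv : ∀ 𝔢 ∈ idealDivisors K 𝔡, 1 / idealTotient K 𝔢 =
      ppMul (fun P _ => 1 / ((Ideal.absNorm P : ℝ) - 1)) 𝔢 := by
    intro 𝔢 he
    have hed := (mem_idealDivisors hd0).1 he
    have hesq := hd.squarefree_of_dvd hed
    rw [idealTotient_of_squarefree hesq, ppMul, one_div, ← Finset.prod_inv_distrib]
    exact Finset.prod_congr rfl fun P _ => (one_div _).symm
  rw [Finset.sum_congr rfl hφinv, sum_divisors_ppMul _ hd0 (fun _ => mem_idealDivisors hd0),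
    idealTotient_of_squarefree hd, Literature.NumberTheory.Sieve.IdealSieve.absNorm_eq_prod_pow hd0,
    ← Finset.prod_div_distrib]
  refine Finset.prod_congr rfl fun P hP => ?_
  have h2 : (2 : ℝ) ≤ Ideal.absNorm P := by
    exact_mod_cast two_le_absNorm_of_prime (prime_of_normalized_factor P (Multiset.mem_toFinset.1 hP))
  have hp1 : (Ideal.absNorm P : ℝ) - 1 ≠ 0 := by linarith
  rw [hcount1 P hP]
  simp only [Finset.sum_range_succ, Finset.sum_range_zero, zero_add, if_true, one_ne_zero, if_false,
    pow_one]
  field_simp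
  ring

/-- `N𝔡/φ(𝔡) ≤ L = ∑_{𝔢 ∈ G1} 1/φ(𝔢)` for good scalars `𝔡`. [cite: CastilloEtAl2015, §2.2] -/
theorem div_totient_le_L {𝔡 : Ideal (𝓞 K)} (hd : 𝔡 ∈ G1 K 𝔴 B) :
    (Ideal.absNorm 𝔡 : ℝ) / idealTotient K 𝔡 ≤ ∑ 𝔢 ∈ G1 K 𝔴 B, 1 / idealTotient K 𝔢 := by
  have h := mem_G1.1 hd
  rw [← sum_divisors_inv_totient h.1.1 h.2.1]
  refine Finset.sum_le_sum_of_subset_of_nonneg (fun 𝔢 he => ?_) fun 𝔢 he _ => ?_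
  · exact mem_G1_of_dvd hd ((mem_idealDivisors h.1.1).1 he)
  · exact le_of_lt (one_div_pos.2 (idealTotient_pos_of_mem_G1 he))

/-- The cofactor of `𝔡` in `𝔯` (`⊤` if `𝔡 ∤ 𝔯`). [folklore] -/
def cof (𝔡 𝔯 : Ideal (𝓞 K)) : Ideal (𝓞 K) := if h : 𝔡 ∣ 𝔯 then Classical.choose h else ⊤

omit [NumberField K] in
/-- `𝔯 = 𝔡 · cof 𝔡 𝔯` when `𝔡 ∣ 𝔯`. [folklore] -/
theorem eq_mul_cof {𝔡 𝔯 : Ideal (𝓞 K)} (h : 𝔡 ∣ 𝔯) : 𝔯 = 𝔡 * cof 𝔡 𝔯 := by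
  rw [cof, dif_pos h]
  exact Classical.choose_spec h

/-- **`λ_max ≤ y_max L^{2k}`** over `𝓞_K` (a crude form of Maynard's (5.9)): for `y` supported on good
tuples of the box with `|y| ≤ y_max`, `|λ_𝔡| ≤ y_max (∑_{𝔢 ∈ G1} 1/φ(𝔢))^{2k}` for every `𝔡`.
[cite: CastilloEtAl2015, §2.2] -/
theorem abs_lam_le {y : (Fin k → Ideal (𝓞 K)) → ℝ} (hy : SupportedOn K k 𝔴 B y) {ymax : ℝ}
    (hymax : ∀ 𝔯, |y 𝔯| ≤ ymax) (𝔡 : Fin k → Ideal (𝓞 K)) :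
    |lam K k B y 𝔡| ≤ ymax * (∑ 𝔢 ∈ G1 K 𝔴 B, 1 / idealTotient K 𝔢) ^ (2 * k) := by
  have hy0 : 0 ≤ ymax := le_trans (abs_nonneg _) (hymax 𝔡)
  set L := ∑ 𝔢 ∈ G1 K 𝔴 B, 1 / idealTotient K 𝔢 with hL
  have hL0 : 0 ≤ L := Finset.sum_nonneg fun 𝔢 he => (one_div_pos.2 (idealTotient_pos_of_mem_G1 he)).le
  by_cases hd : 𝔡 ∈ boxG K k 𝔴 B
  swap
  · rw [lam_eq_zero_of_not hy hd, abs_zero]; positivity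
  have hdG := apply_mem_G1_of_mem_boxG hd
  have hdgood := (mem_boxG.1 hd).2
  have hd0 : ∀ i, 𝔡 i ≠ ⊥ := fun i => hdgood.ne_bot i
  have hφpos : ∀ 𝔯 : Fin k → Ideal (𝓞 K), (∀ i, 𝔯 i ≠ ⊥) → 0 < ∏ i, idealTotient K (𝔯 i) :=
    fun 𝔯 h => Finset.prod_pos fun i _ => idealTotient_pos (h i)
  rw [lam_def, abs_mul]
  have hprod : |∏ i, (idealMoebius (𝔡 i) : ℝ) * (Ideal.absNorm (𝔡 i) : ℝ)| = ∏ i, (Ideal.absNorm (𝔡 i) : ℝ) := by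
    rw [Finset.prod_mul_distrib, abs_mul, abs_prod_moebius_eq_one hdG, one_mul, abs_of_nonneg]
    exact Finset.prod_nonneg fun i _ => Nat.cast_nonneg _
  rw [hprod]
  have hsum : |∑ 𝔯 ∈ (box K k B).filter (fun 𝔯 => ∀ i, 𝔡 i ∣ 𝔯 i), y 𝔯 / ∏ i, idealTotient K (𝔯 i)| ≤
      ymax * ((∏ i, 1 / idealTotient K (𝔡 i)) * L ^ k) := by
    calc |∑ 𝔯 ∈ (box K k B).filter (fun 𝔯 => ∀ i, 𝔡 i ∣ 𝔯 i), y 𝔯 / ∏ i, idealTotient K (𝔯 i)|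
        ≤ ∑ 𝔯 ∈ (box K k B).filter (fun 𝔯 => ∀ i, 𝔡 i ∣ 𝔯 i), |y 𝔯| / ∏ i, idealTotient K (𝔯 i) := by
          refine (Finset.abs_sum_le_sum_abs _ _).trans (Finset.sum_le_sum fun 𝔯 hr => ?_)
          rw [Finset.mem_filter, mem_box_iff] at hr
          rw [abs_div, abs_of_pos (hφpos 𝔯 fun i => (hr.1 i).1)]
      _ = ∑ 𝔯 ∈ (boxG K k 𝔴 B).filter (fun 𝔯 => ∀ i, 𝔡 i ∣ 𝔯 i), |y 𝔯| / ∏ i, idealTotient K (𝔯 i) := by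
          symm
          refine Finset.sum_subset (fun 𝔯 hr => ?_) fun 𝔯 hr hnr => ?_
          · rw [Finset.mem_filter, mem_boxG] at hr
            exact Finset.mem_filter.2 ⟨hr.1.1, hr.2⟩
          · rw [Finset.mem_filter] at hr
            have : y 𝔯 = 0 := by
              by_contra h
              exact hnr (Finset.mem_filter.2 ⟨mem_boxG.2 ⟨hr.1, (hy 𝔯 h).2⟩, hr.2⟩)
            rw [this, abs_zero, zero_div]
      _ ≤ ∑ 𝔯 ∈ (boxG K k 𝔴 B).filter (fun 𝔯 => ∀ i, 𝔡 i ∣ 𝔯 i), ymax / ∏ i, idealTotient K (𝔯 i) := by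
          refine Finset.sum_le_sum fun 𝔯 hr => ?_
          rw [Finset.mem_filter, mem_boxG, mem_box_iff] at hr
          exact div_le_div_of_nonneg_right (hymax 𝔯) (hφpos 𝔯 fun i => (hr.1.1 i).1).le
      _ = ymax * ∑ 𝔯 ∈ (boxG K k 𝔴 B).filter (fun 𝔯 => ∀ i, 𝔡 i ∣ 𝔯 i),
            ∏ i, 1 / idealTotient K (𝔯 i) := by
          rw [Finset.mul_sum]
          refine Finset.sum_congr rfl fun 𝔯 _ => ?_
          rw [div_eq_mul_one_div, one_div, ← Finset.prod_inv_distrib]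
          simp only [one_div]
      _ ≤ ymax * ((∏ i, 1 / idealTotient K (𝔡 i)) * L ^ k) := by
          refine mul_le_mul_of_nonneg_left ?_ hy0
          -- inject `𝔯 ↦ 𝔱 = cofactors` into `G1^k`, with `1/φ(𝔯ᵢ) = (1/φ(𝔡ᵢ)) (1/φ(𝔱ᵢ))`
          have hinjOn : Set.InjOn (fun 𝔯 : Fin k → Ideal (𝓞 K) => fun i => cof (𝔡 i) (𝔯 i))
              ((boxG K k 𝔴 B).filter (fun 𝔯 => ∀ i, 𝔡 i ∣ 𝔯 i) : Set (Fin k → Ideal (𝓞 K))) := by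
            intro 𝔯 hr 𝔯' hr' h
            rw [Finset.mem_coe, Finset.mem_filter] at hr hr'
            funext i
            have h1 := congrFun h i
            simp only at h1
            rw [eq_mul_cof (hr.2 i), eq_mul_cof (hr'.2 i), h1]
          have hinj : ∑ 𝔯 ∈ (boxG K k 𝔴 B).filter (fun 𝔯 => ∀ i, 𝔡 i ∣ 𝔯 i),
              ∏ i, 1 / idealTotient K (𝔯 i) ≤
              ∑ 𝔱 ∈ Fintype.piFinset (fun _ : Fin k => G1 K 𝔴 B),
                (∏ i, 1 / idealTotient K (𝔡 i)) * ∏ i, 1 / idealTotient K (𝔱 i) := by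
            calc ∑ 𝔯 ∈ (boxG K k 𝔴 B).filter (fun 𝔯 => ∀ i, 𝔡 i ∣ 𝔯 i), ∏ i, 1 / idealTotient K (𝔯 i)
                = ∑ 𝔯 ∈ (boxG K k 𝔴 B).filter (fun 𝔯 => ∀ i, 𝔡 i ∣ 𝔯 i),
                    (∏ i, 1 / idealTotient K (𝔡 i)) * ∏ i, 1 / idealTotient K (cof (𝔡 i) (𝔯 i)) := by
                  refine Finset.sum_congr rfl fun 𝔯 hr => ?_
                  rw [Finset.mem_filter] at hr
                  rw [← Finset.prod_mul_distrib]
                  refine Finset.prod_congr rfl fun i _ => ?_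
                  have hri := (mem_boxG.1 hr.1).2.squarefree_apply i
                  have ht := eq_mul_cof (hr.2 i)
                  have hcop : 𝔡 i ⊔ cof (𝔡 i) (𝔯 i) = ⊤ :=
                    sup_eq_top_of_squarefree_mul (𝔯 := 𝔡 i) (𝔪 := cof (𝔡 i) (𝔯 i)) (by rw [← ht]; exact hri)
                  rw [congrArg (idealTotient K) ht, idealTotient_mul_of_coprime _ _ hcop, one_div_mul_one_div]
              _ = ∑ 𝔱 ∈ ((boxG K k 𝔴 B).filter (fun 𝔯 => ∀ i, 𝔡 i ∣ 𝔯 i)).image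
                    (fun 𝔯 : Fin k → Ideal (𝓞 K) => fun i => cof (𝔡 i) (𝔯 i)),
                    (∏ i, 1 / idealTotient K (𝔡 i)) * ∏ i, 1 / idealTotient K (𝔱 i) :=
                  (Finset.sum_image (f := fun 𝔱 : Fin k → Ideal (𝓞 K) =>
                    (∏ i, 1 / idealTotient K (𝔡 i)) * ∏ i, 1 / idealTotient K (𝔱 i)) hinjOn).symm
              _ ≤ _ := by
                  refine Finset.sum_le_sum_of_subset_of_nonneg ?_ ?_
                  · intro 𝔱 ht
                    rw [Finset.mem_image] at ht
                    obtain ⟨𝔯, hr, rfl⟩ := ht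
                    rw [Finset.mem_filter] at hr
                    rw [Fintype.mem_piFinset]
                    intro i
                    refine mem_G1_of_dvd (apply_mem_G1_of_mem_boxG hr.1 i) ⟨𝔡 i, ?_⟩
                    rw [mul_comm]; exact eq_mul_cof (hr.2 i)
                  · intro 𝔱 ht _
                    rw [Fintype.mem_piFinset] at ht
                    refine mul_nonneg (Finset.prod_nonneg fun i _ => ?_) (Finset.prod_nonneg fun i _ => ?_)
                    · exact (one_div_pos.2 (idealTotient_pos (hd0 i))).le
                    · exact (one_div_pos.2 (idealTotient_pos_of_mem_G1 (ht i))).le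
          refine hinj.trans (le_of_eq ?_)
          rw [← Finset.mul_sum, ← Finset.prod_univ_sum (fun _ : Fin k => G1 K 𝔴 B)
            (fun _ 𝔫 => 1 / idealTotient K 𝔫), Finset.prod_const, Finset.card_univ, Fintype.card_fin]
  calc (∏ i, (Ideal.absNorm (𝔡 i) : ℝ)) * |∑ 𝔯 ∈ (box K k B).filter (fun 𝔯 => ∀ i, 𝔡 i ∣ 𝔯 i),
          y 𝔯 / ∏ i, idealTotient K (𝔯 i)|
      ≤ (∏ i, (Ideal.absNorm (𝔡 i) : ℝ)) * (ymax * ((∏ i, 1 / idealTotient K (𝔡 i)) * L ^ k)) :=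
        mul_le_mul_of_nonneg_left hsum (Finset.prod_nonneg fun i _ => Nat.cast_nonneg _)
    _ = ymax * ((∏ i, (Ideal.absNorm (𝔡 i) : ℝ) / idealTotient K (𝔡 i)) * L ^ k) := by
        rw [show (∏ i, (Ideal.absNorm (𝔡 i) : ℝ) / idealTotient K (𝔡 i)) =
            (∏ i, (Ideal.absNorm (𝔡 i) : ℝ)) * ∏ i, 1 / idealTotient K (𝔡 i) by
          rw [← Finset.prod_mul_distrib]
          exact Finset.prod_congr rfl fun i _ => div_eq_mul_one_div _ _]
        ring
    _ ≤ ymax * (L ^ k * L ^ k) := by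
        refine mul_le_mul_of_nonneg_left (mul_le_mul_of_nonneg_right ?_ (pow_nonneg hL0 k)) hy0
        calc ∏ i, (Ideal.absNorm (𝔡 i) : ℝ) / idealTotient K (𝔡 i) ≤ ∏ _i : Fin k, L :=
              Finset.prod_le_prod (fun i _ => (div_pos (by
                  exact_mod_cast Nat.pos_of_ne_zero (by rw [Ne, Ideal.absNorm_eq_zero_iff]; exact hd0 i))
                (idealTotient_pos (hd0 i))).le) fun i _ => div_totient_le_L (hdG i)
          _ = L ^ k := by rw [Finset.prod_const, Finset.card_univ, Fintype.card_fin]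
    _ = ymax * L ^ (2 * k) := by rw [two_mul, pow_add]

end LamBound

end Literature.NumberTheory.Sieve.MaynardNF
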